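import Literature.MathematicalPhysics.QuantumManyBody.PeriodicBoseGasLemma33
import Literature.MathematicalPhysics.QuantumManyBody.PeriodicBoseGasThm31
import Mathlib.Analysis.Distribution.SchwartzSpace.Fourier
import Mathlib.Analysis.Distribution.SchwartzSpace.Deriv
import Mathlib.Analysis.SpecialFunctions.JapaneseBracket
import Mathlib.Analysis.SpecialFunctions.Trigonometric.Bounds
import Mathlib.Analysis.Calculus.MeanValue
import Mathlib.MeasureTheory.Measure.Haar.NormedSpace
import HarnessLib

/-!
# Fournais 2020, (3.21): proof of the multiplier bound, and Lemma 3.3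

Topic `Literature/MathematicalPhysics/QuantumManyBody` (provefact
`Literature.MathematicalPhysics.QuantumManyBody.BoseGas.Fournais2020_condensation`). We discharge the named fact `Fournais2020_eq321`
(`PeriodicBoseGasKineticMultiplier.lean`), the multiplier bound
"`F(k) ≤ k² - 2π²L⁻²` for `k ∈ 2πL⁻¹ℤ³ ∖ {0}` if `b, s` are small enough" [Fournais2020, (3.21)]
behind the kinetic-energy localisation Lemma 3.3, and hence, by
`Fournais2020_lemma33_of_eq321` (`PeriodicBoseGasLemma33.lean`), Lemma 3.3 itself
(`Fournais2020_lemma33_holds`).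

## The argument [Fournais2020, pp. 16–17, (3.22)–(3.29)], as formalised

Write `e_n(x) = 𝐞(⟨x,k⟩)`, `k = n/L ∈ L⁻¹ℤ³` (Mathlib's `𝐞(t) = e^{2πit}`, so the momentum is
`2πk`), `Λ = Λ(0) = [-ℓ/2,ℓ/2]³`, `c := ℓ⁻³∫_Λ e_n` (so `Q_0 e_n = 1_Λ(e_n - c)`),
`χ_ℓ := χ(·/ℓ)` (supported in `Λ`) and `φ := 𝓕χ` (a Schwartz function: `χ ∈ C_c^∞`). Then
`χ_0 Q_0 e_n = χ_ℓ (e_n - c)`, `𝓕(χ_ℓ(e_n - c))(p) = ℓ³(φ(ℓp - K) - cφ(ℓp))` with `K := ℓk`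
(dilation and modulation), and the change of variables `q = ℓp` gives ("reduce by scaling to
`ℓ = 1`")
`ℓ⁻³⟨e_n, T_0 e_n⟩ = ℓ⁻²(G₁(K) + b ℓ⁻³‖Q_0e_n‖²)`,
`G₁(K) = ∫ (4π²q² - s⁻²)₊ |φ(q-K) - cφ(q)|² dq`,
and (3.21) becomes `G₁ + bℓ⁻³‖Q_0e_n‖² + 2π²(ℓ/L)² ≤ 4π²K²` for `K ∈ (ℓ/L)(ℤ³∖0)`; as `|K| ≥ ℓ/L`
and `ℓ/L < ½` it suffices that `G ≤ 2π²K²` for `|K| ≤ (4πs)⁻¹` and `G ≤ 4π²K² - π²/2` for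
`|K| ≥ (4πs)⁻¹` (the paper's `|k| ≶ ½s⁻¹`).

* *Large `|K|`* ((3.26)–(3.29)). `|φ(q-K) - cφ(q)|² ≤ φ(q-K)² + 2|φ(q-K)||φ(q)| + φ(q)²`
  (`|c| ≤ 1`). The main term is (3.27) with `ε = ½`:
  `∫(4π²q²-s⁻²)₊φ(q-K)² = ∫(4π²(q+K)²-s⁻²)₊φ² ≤ ∫(4π²(q+K)² - s⁻²)φ² + ∫(s⁻² - 2π²K² + 4π²q²)₊φ²`
  `≤ 4π²K² - s⁻² + ⅞s⁻² + 2∫4π²q²φ²` (Plancherel `∫φ² = ∫χ² = 1`, the cross term `∫⟨q,K⟩φ²`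
  vanishes by parity, and `2π²K² ≥ ⅛s⁻²`), i.e. (3.29) `≤ 4π²K² - ⅛s⁻² + C`; the two other
  terms are bounded ((3.26): `(4π²q²-s⁻²)₊ ≤ 4π²q²`, `φ` bounded with finite moments), and so
  is the `Q`-term (`|e_n - c| ≤ 2`). Hence `G ≤ 4π²K² - ⅛s⁻² + C' ≤ 4π²K² - π²/2` for `s` small.
* *Small `|K|`* ((3.24)–(3.25)). `|φ(q-K) - cφ(q)|² ≤ 2|φ(q-K) - φ(q)|² + 2|1-c|²φ(q)²`. On the
  support of `(4π²q²-s⁻²)₊` we have `|q| > (2πs)⁻¹ ≥ 2|K|`, so the segment `[q-K,q]` stays in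
  `|z| ≥ |q|/2` where `|∇φ(z)| ≤ C₁(1+|z|)⁻⁴` (Schwartz decay), and `1 ≤ (2πs|q|)²`; the mean
  value inequality gives `∫(4π²q²-s⁻²)₊|φ(q-K)-φ(q)|² ≤ C s²K²` (this is (3.25), `F₁ ≤ CsK²`,
  obtained directly rather than through `∂²F₁`). The geometry of the box gives
  `|e_n(x) - c| ≤ 2√3π|K|` on `Λ` (so `|1 - c| ≤ 2√3π|K|` and `ℓ⁻³‖Q_0e_n‖² ≤ 12π²K²`, which is
  (3.24) `F₂ ≤ bβk²`), and `∫(4π²q²-s⁻²)₊φ² ≤ 16π⁴s²∫q⁴φ²`. Hence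
  `G ≤ C''s²K² + 12π²bK² ≤ 2π²K²` for `b = 1/24` and `s` small.

All constants are moments/seminorms of the Schwartz function `φ = 𝓕χ` and depend on `χ` only.

## References

* [Fournais2020] S. Fournais, *Length scales for BEC in the dilute Bose gas*, arXiv:2011.00309,
  EMS Ser. Congr. Rep. 18 (2021): Lemma 3.3, (3.18)–(3.29).
-/

noncomputable section

open MeasureTheory Filter Set WithLp Complex FourierTransform
open scoped ENNReal NNReal Topology RealInnerProductSpace SchwartzMap

namespace Literature.MathematicalPhysics.QuantumManyBody.BoseGas

/-! ### The multiplier `τ_s(q) = (4π²|q|² - s⁻²)₊` (3.18): elementary bounds -/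

section Tau

/-- `(4π²q² - s⁻²)₊ ≤ 4π²q²`. [cite: Fournais2020, (3.18)] -/
theorem tau_le_sq (s : ℝ) (q : Space) :
    max (4 * Real.pi ^ 2 * ‖q‖ ^ 2 - s⁻¹ ^ 2) 0 ≤ 4 * Real.pi ^ 2 * ‖q‖ ^ 2 := by
  refine max_le ?_ (by positivity)
  nlinarith [sq_nonneg s⁻¹]

/-- On the support of `(4π²q² - s⁻²)₊` one has `1 ≤ (2πs|q|)²`, whence
`(4π²q² - s⁻²)₊ ≤ 16π⁴s²q⁴`. [cite: Fournais2020, (3.25)] -/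
theorem tau_le_pow_four {s : ℝ} (hs : 0 < s) (q : Space) :
    max (4 * Real.pi ^ 2 * ‖q‖ ^ 2 - s⁻¹ ^ 2) 0 ≤ 16 * Real.pi ^ 4 * s ^ 2 * ‖q‖ ^ 4 := by
  refine max_le ?_ (by positivity)
  by_cases h : 4 * Real.pi ^ 2 * ‖q‖ ^ 2 ≤ s⁻¹ ^ 2
  · have : (0 : ℝ) ≤ 16 * Real.pi ^ 4 * s ^ 2 * ‖q‖ ^ 4 := by positivity
    linarith
  · push Not at h
    -- `1 < 4π²s²q²`
    have h1 : 1 < 4 * Real.pi ^ 2 * s ^ 2 * ‖q‖ ^ 2 := by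
      have := mul_lt_mul_of_pos_left h (pow_pos hs 2)
      rw [inv_pow, mul_inv_cancel₀ (pow_ne_zero 2 hs.ne')] at this
      linarith
    have h2 : 0 ≤ 4 * Real.pi ^ 2 * ‖q‖ ^ 2 := by positivity
    have h3 : 4 * Real.pi ^ 2 * ‖q‖ ^ 2 ≤ 4 * Real.pi ^ 2 * ‖q‖ ^ 2 * (4 * Real.pi ^ 2 * s ^ 2 * ‖q‖ ^ 2) :=
      le_mul_of_one_le_right h2 h1.le
    have h4 : (0 : ℝ) ≤ s⁻¹ ^ 2 := by positivity
    nlinarith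

/-- On the support of `(4π²q² - s⁻²)₊`, `|q| > (2πs)⁻¹`; in particular `|q| > 2|K|` whenever
`|K| ≤ (4πs)⁻¹`. [cite: Fournais2020, (3.25)] -/
theorem two_mul_norm_lt_of_tau_pos {s : ℝ} (hs : 0 < s) {q K : Space}
    (hq : 0 < max (4 * Real.pi ^ 2 * ‖q‖ ^ 2 - s⁻¹ ^ 2) 0) (hK : ‖K‖ ≤ (4 * Real.pi * s)⁻¹) :
    2 * ‖K‖ < ‖q‖ := by
  have h : s⁻¹ ^ 2 < 4 * Real.pi ^ 2 * ‖q‖ ^ 2 := by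
    rcases lt_max_iff.1 hq with h | h
    · linarith
    · exact absurd h (lt_irrefl 0)
  have hπ : 0 < Real.pi := Real.pi_pos
  have h2K : 2 * ‖K‖ ≤ (2 * Real.pi * s)⁻¹ := by
    calc 2 * ‖K‖ ≤ 2 * (4 * Real.pi * s)⁻¹ := by gcongr
      _ = (2 * Real.pi * s)⁻¹ := by field_simp; ring
  refine lt_of_le_of_lt h2K ?_
  -- `(2πs)⁻¹ < |q|` from `s⁻² < 4π²q²`
  have hpos : 0 < 2 * Real.pi * s := by positivity
  rw [inv_lt_iff_one_lt_mul₀ hpos]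
  have hq0 : 0 ≤ ‖q‖ := norm_nonneg q
  have this : 1 < (2 * Real.pi * s * ‖q‖) ^ 2 := by
    have := mul_lt_mul_of_pos_left h (pow_pos hs 2)
    rw [inv_pow, mul_inv_cancel₀ (pow_ne_zero 2 hs.ne')] at this
    nlinarith
  have ht : 0 ≤ 2 * Real.pi * s * ‖q‖ := by positivity
  have h1t : 1 < 2 * Real.pi * s * ‖q‖ := by
    by_contra hle
    push Not at hle
    have := pow_le_one₀ ht hle (n := 2)
    linarith
  linarith [mul_comm ‖q‖ (2 * Real.pi * s)]

end Tau

/-! ### The wave vector `k = n/L`, and the geometry of the box `Λ(0)` -/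

section WaveVector

variable {ℓ L : ℝ}

/-- `e_n(x) = 𝐞(⟨x, k⟩)` with `k = n/L` (`𝐞(t) = e^{2πit}`). [cite: Fournais2020, (3.19)] -/
theorem cellWave_eq_fourierChar (L : ℝ) (n : Fin 3 → ℤ) (x : Space) :
    cellWave L n x = (Real.fourierChar ⟪x, toLp 2 fun j => (n j : ℝ) / L⟫ : ℂ) := by
  rw [cellWave_apply, Real.fourierChar_apply]
  congr 1
  have : ⟪x, toLp 2 fun j => (n j : ℝ) / L⟫ = (∑ k, (n k : ℝ) * x k) / L := by
    rw [PiLp.inner_apply, Finset.sum_div]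
    refine Finset.sum_congr rfl fun j _ => ?_
    simp only [RCLike.inner_apply, conj_trivial]
    ring
  rw [this]
  push_cast
  ring

/-- `|ℓk|² = ℓ² ∑ⱼ nⱼ² / L²` for `k = n/L`. [cite: Fournais2020, (3.21)] -/
theorem norm_sq_smul_waveVector (ℓ L : ℝ) (n : Fin 3 → ℤ) :
    ‖ℓ • (toLp 2 fun j => (n j : ℝ) / L : Space)‖ ^ 2 = ℓ ^ 2 * (∑ j, (n j : ℝ) ^ 2) / L ^ 2 := by
  rw [norm_smul, mul_pow, Real.norm_eq_abs, sq_abs, EuclideanSpace.real_norm_sq_eq]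
  rw [mul_div_assoc, Finset.sum_div]
  congr 1
  refine Finset.sum_congr rfl fun j _ => ?_
  ring

/-- `∑ⱼ nⱼ² ≥ 1` for `n ∈ ℤ³ ∖ {0}`. [folklore] -/
theorem one_le_sum_sq_of_ne_zero {n : Fin 3 → ℤ} (hn : n ≠ 0) : (1 : ℝ) ≤ ∑ j, (n j : ℝ) ^ 2 := by
  obtain ⟨j, hj⟩ : ∃ j, n j ≠ 0 := by
    by_contra h
    push Not at h
    exact hn (funext h)
  have h1 : (1 : ℝ) ≤ (n j : ℝ) ^ 2 := by
    have : (1 : ℤ) ≤ (n j) ^ 2 := by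
      have := Int.one_le_abs hj
      nlinarith [sq_abs (n j)]
    exact_mod_cast this
  exact h1.trans (Finset.single_le_sum (f := fun j => (n j : ℝ) ^ 2) (fun i _ => sq_nonneg _)
    (Finset.mem_univ j))

/-- Points of `Λ(0)` have norm at most `√3 ℓ/2`… we only need: two points of `Λ(0)` are at
distance at most `√3 ℓ`. [cite: Fournais2020, (3.4)] -/
theorem norm_sub_le_of_mem_slidingBox (hℓ : 0 ≤ ℓ) {x y : Space} (hx : x ∈ slidingBox ℓ 0)
    (hy : y ∈ slidingBox ℓ 0) : ‖x - y‖ ≤ Real.sqrt 3 * ℓ := by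
  have hcoord : ∀ j, (x j - y j) ^ 2 ≤ ℓ ^ 2 := by
    intro j
    have h1 := hx j
    have h2 := hy j
    simp only [PiLp.zero_apply, sub_zero, Set.mem_Icc] at h1 h2
    have : |x j - y j| ≤ ℓ := by rw [abs_le]; constructor <;> linarith
    calc (x j - y j) ^ 2 = |x j - y j| ^ 2 := (sq_abs _).symm
      _ ≤ ℓ ^ 2 := pow_le_pow_left₀ (abs_nonneg _) this 2
  have hsq : ‖x - y‖ ^ 2 ≤ (Real.sqrt 3 * ℓ) ^ 2 := by
    rw [EuclideanSpace.real_norm_sq_eq, mul_pow, Real.sq_sqrt (by norm_num)]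
    calc ∑ j, ((x - y) j) ^ 2 = ∑ j : Fin 3, (x j - y j) ^ 2 := by simp
      _ ≤ ∑ _j : Fin 3, ℓ ^ 2 := Finset.sum_le_sum fun j _ => hcoord j
      _ = 3 * ℓ ^ 2 := by simp
  exact (sq_le_sq₀ (norm_nonneg _) (by positivity)).1 hsq

/-- `0 ∈ Λ(0)`. [cite: Fournais2020, (3.4)] -/
theorem zero_mem_slidingBox (hℓ : 0 ≤ ℓ) : (0 : Space) ∈ slidingBox ℓ 0 := by
  intro k
  simp only [PiLp.zero_apply, sub_zero, Set.mem_Icc]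
  constructor <;> linarith

/-- `|𝐞(a) - 𝐞(b)| ≤ 2π|a - b|`. [folklore] -/
theorem norm_fourierChar_sub_le (a b : ℝ) :
    ‖(Real.fourierChar a : ℂ) - Real.fourierChar b‖ ≤ 2 * Real.pi * |a - b| := by
  have h : (Real.fourierChar a : ℂ) - Real.fourierChar b =
      Real.fourierChar b * (Complex.exp (Complex.I * (2 * Real.pi * (a - b) : ℝ)) - 1) := by
    rw [mul_sub, mul_one, show Complex.I * ((2 * Real.pi * (a - b) : ℝ) : ℂ) =
      ((2 * Real.pi * (a - b) : ℝ) : ℂ) * Complex.I by ring, ← Real.fourierChar_apply,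
      ← Circle.coe_mul, ← AddChar.map_add_eq_mul, add_sub_cancel]
  rw [h, norm_mul, Circle.norm_coe, one_mul]
  refine (Real.norm_exp_I_mul_ofReal_sub_one_le).trans ?_
  rw [Real.norm_eq_abs, abs_mul, abs_of_pos (by positivity : (0 : ℝ) < 2 * Real.pi)]

/-- `|e_n(x) - e_n(y)| ≤ 2π|k||x - y|`. [cite: Fournais2020, (3.19)] -/
theorem norm_cellWave_sub_le (L : ℝ) (n : Fin 3 → ℤ) (x y : Space) :
    ‖cellWave L n x - cellWave L n y‖ ≤
      2 * Real.pi * ‖(toLp 2 fun j => (n j : ℝ) / L : Space)‖ * ‖x - y‖ := by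
  rw [cellWave_eq_fourierChar, cellWave_eq_fourierChar]
  set k : Space := toLp 2 fun j => (n j : ℝ) / L
  refine (norm_fourierChar_sub_le _ _).trans ?_
  rw [← inner_sub_left (𝕜 := ℝ) x y k]
  have h1 : |⟪x - y, k⟫| ≤ ‖x - y‖ * ‖k‖ := abs_real_inner_le_norm (x - y) k
  have h2 : (0 : ℝ) ≤ 2 * Real.pi := by positivity
  have h3 := mul_le_mul_of_nonneg_left h1 h2
  linarith [h3, mul_comm ‖x - y‖ ‖k‖]

end WaveVector

/-! ### The box average `c = ℓ⁻³∫_Λ e_n` and `Q_0 e_n = 1_Λ (e_n - c)` -/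

section BoxAverage

variable {ℓ L : ℝ}

/-- `|Λ(u)| = ℓ³` (real form). [cite: Fournais2020, (3.4)] -/
theorem volume_real_slidingBox (hℓ : 0 ≤ ℓ) (u : Space) : volume.real (slidingBox ℓ u) = ℓ ^ 3 := by
  rw [Measure.real, volume_slidingBox, ← ENNReal.ofReal_pow hℓ, ENNReal.toReal_ofReal (by positivity)]

/-- The box has finite volume. [cite: Fournais2020, (3.4)] -/
theorem volume_slidingBox_lt_top (ℓ : ℝ) (u : Space) : volume (slidingBox ℓ u) < ⊤ := by
  rw [volume_slidingBox]; exact ENNReal.pow_lt_top ENNReal.ofReal_lt_top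

/-- `e_n(x) - c = ℓ⁻³ ∫_Λ (e_n(x) - e_n(y)) dy`, `c = ℓ⁻³∫_Λ e_n` the box average.
[cite: Fournais2020, (3.5)] -/
theorem cellWave_sub_boxAverage (hℓ : 0 < ℓ) (L : ℝ) (n : Fin 3 → ℤ) (x : Space) :
    cellWave L n x - ((ℓ ^ 3)⁻¹ : ℝ) • ∫ y in slidingBox ℓ 0, cellWave L n y =
      ((ℓ ^ 3)⁻¹ : ℝ) • ∫ y in slidingBox ℓ 0, (cellWave L n x - cellWave L n y) := by
  rw [integral_sub (integrableOn_slidingBox continuous_const ℓ 0)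
      (integrableOn_cellWave_slidingBox ℓ L n 0), setIntegral_const, volume_real_slidingBox hℓ.le,
    smul_sub, ← smul_assoc, smul_eq_mul, inv_mul_cancel₀ (pow_ne_zero 3 hℓ.ne'), one_smul]

/-- **`F₂ ≤ bβk²`, pointwise form**: `|e_n(x) - c| ≤ 2√3π|K|` on `Λ`, `K = ℓ n/L`.
[cite: Fournais2020, (3.24)] -/
theorem norm_cellWave_sub_boxAverage_le (hℓ : 0 < ℓ) (L : ℝ) (n : Fin 3 → ℤ) {x : Space}
    (hx : x ∈ slidingBox ℓ 0) :
    ‖cellWave L n x - ((ℓ ^ 3)⁻¹ : ℝ) • ∫ y in slidingBox ℓ 0, cellWave L n y‖ ≤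
      2 * Real.sqrt 3 * Real.pi * ‖ℓ • (toLp 2 fun j => (n j : ℝ) / L : Space)‖ := by
  set k : Space := toLp 2 fun j => (n j : ℝ) / L
  rw [cellWave_sub_boxAverage hℓ, norm_smul, Real.norm_eq_abs, abs_of_pos (by positivity),
    norm_smul, Real.norm_eq_abs, abs_of_pos hℓ]
  have hbound : ∀ y ∈ slidingBox ℓ 0, ‖cellWave L n x - cellWave L n y‖ ≤
      2 * Real.pi * ‖k‖ * (Real.sqrt 3 * ℓ) := fun y hy =>
    (norm_cellWave_sub_le L n x y).trans
      (mul_le_mul_of_nonneg_left (norm_sub_le_of_mem_slidingBox hℓ.le hx hy) (by positivity))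
  have h := norm_setIntegral_le_of_norm_le_const (volume_slidingBox_lt_top ℓ 0) hbound
  rw [volume_real_slidingBox hℓ.le] at h
  calc (ℓ ^ 3)⁻¹ * ‖∫ y in slidingBox ℓ 0, (cellWave L n x - cellWave L n y)‖
      ≤ (ℓ ^ 3)⁻¹ * (2 * Real.pi * ‖k‖ * (Real.sqrt 3 * ℓ) * ℓ ^ 3) := by gcongr
    _ = 2 * Real.sqrt 3 * Real.pi * (ℓ * ‖k‖) := by field_simp

/-- `|c| ≤ 1`. [cite: Fournais2020, (3.5)] -/
theorem norm_boxAverage_le_one (hℓ : 0 < ℓ) (L : ℝ) (n : Fin 3 → ℤ) :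
    ‖((ℓ ^ 3)⁻¹ : ℝ) • ∫ y in slidingBox ℓ 0, cellWave L n y‖ ≤ 1 := by
  rw [norm_smul, Real.norm_eq_abs, abs_of_pos (by positivity)]
  have h := norm_setIntegral_le_of_norm_le_const (C := 1) (volume_slidingBox_lt_top ℓ 0)
    (fun y _ => (norm_cellWave L n y).le)
  rw [volume_real_slidingBox hℓ.le, one_mul] at h
  calc (ℓ ^ 3)⁻¹ * ‖∫ y in slidingBox ℓ 0, cellWave L n y‖ ≤ (ℓ ^ 3)⁻¹ * ℓ ^ 3 := by gcongr
    _ = 1 := inv_mul_cancel₀ (pow_ne_zero 3 hℓ.ne')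

/-- `|e_n(x) - c| ≤ 2`. [cite: Fournais2020, (3.26)] -/
theorem norm_cellWave_sub_boxAverage_le_two (hℓ : 0 < ℓ) (L : ℝ) (n : Fin 3 → ℤ) (x : Space) :
    ‖cellWave L n x - ((ℓ ^ 3)⁻¹ : ℝ) • ∫ y in slidingBox ℓ 0, cellWave L n y‖ ≤ 2 :=
  (norm_sub_le _ _).trans (by
    rw [norm_cellWave]
    linarith [norm_boxAverage_le_one hℓ L n])

/-- **`χ_0 Q_0 e_n = χ_ℓ (e_n - c)`** with `χ_ℓ = χ(·/ℓ)` (supported in `Λ(0)`).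
[cite: Fournais2020, (3.13), (3.20)] -/
theorem locFun_mul_projQ_cellWave {χ : Space → ℝ} (hχ : IsLocalizationFunction χ) (hℓ : 0 < ℓ)
    (L : ℝ) (n : Fin 3 → ℤ) (x : Space) :
    (locFun χ ℓ 0 x : ℂ) * projQ ℓ 0 (cellWave L n) x =
      (χ (ℓ⁻¹ • x) : ℂ) *
        (cellWave L n x - ((ℓ ^ 3)⁻¹ : ℝ) • ∫ y in slidingBox ℓ 0, cellWave L n y) := by
  have hloc : locFun χ ℓ 0 x = χ (ℓ⁻¹ • x) := by simp [locFun]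
  by_cases hx : x ∈ slidingBox ℓ 0
  · rw [hloc]
    unfold projQ
    rw [indicator_of_mem hx]
  · have h0 := locFun_eq_zero_of_not_mem hχ hℓ hx
    rw [h0] at hloc
    rw [h0, ← hloc]
    simp

/-- `χ_ℓ = χ(·/ℓ)` vanishes off `Λ(0)`. [cite: Fournais2020, (3.6)] -/
theorem dilate_eq_zero_of_not_mem {χ : Space → ℝ} (hχ : IsLocalizationFunction χ) (hℓ : 0 < ℓ)
    {x : Space} (hx : x ∉ slidingBox ℓ 0) : χ (ℓ⁻¹ • x) = 0 := by
  have := locFun_eq_zero_of_not_mem hχ hℓ hx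
  simpa [locFun] using this

/-- `χ_ℓ` is continuous with compact support, hence integrable (complex-valued form).
[cite: Fournais2020, (2.2)] -/
theorem integrable_dilate {χ : Space → ℝ} (hχ : IsLocalizationFunction χ) (hℓ : 0 < ℓ) :
    Integrable (fun x : Space => (χ (ℓ⁻¹ • x) : ℂ)) := by
  refine Continuous.integrable_of_hasCompactSupport
    (Complex.continuous_ofReal.comp (hχ.continuous.comp (continuous_const_smul _))) ?_
  exact HasCompactSupport.intro (isCompact_slidingBox ℓ 0) fun x hx => by
    simp [dilate_eq_zero_of_not_mem hχ hℓ hx]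

/-- `e_n χ_ℓ` is integrable. [cite: Fournais2020, (2.2)] -/
theorem integrable_cellWave_mul_dilate {χ : Space → ℝ} (hχ : IsLocalizationFunction χ)
    (hℓ : 0 < ℓ) (L : ℝ) (n : Fin 3 → ℤ) :
    Integrable (fun x : Space => cellWave L n x * (χ (ℓ⁻¹ • x) : ℂ)) := by
  refine Continuous.integrable_of_hasCompactSupport ((continuous_cellWave L n).mul
    (Complex.continuous_ofReal.comp (hχ.continuous.comp (continuous_const_smul _)))) ?_
  exact HasCompactSupport.intro (isCompact_slidingBox ℓ 0) fun x hx => by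
    simp [dilate_eq_zero_of_not_mem hχ hℓ hx]

end BoxAverage

/-! ### Fourier transform: dilation, modulation, and `𝓕(χ_0Q_0e_n)` -/

section FourierComputation

variable {ℓ L : ℝ}

/-- **Dilation**: `𝓕[g(·/ℓ)](p) = ℓ³ 𝓕g(ℓp)`. [folklore] -/
theorem fourier_comp_inv_smul (hℓ : 0 < ℓ) (g : Space → ℂ) (p : Space) :
    𝓕 (fun x => g (ℓ⁻¹ • x)) p = (ℓ ^ 3 : ℝ) • 𝓕 g (ℓ • p) := by
  rw [Real.fourier_eq, Real.fourier_eq]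
  have h : (fun v : Space => Real.fourierChar (-⟪v, p⟫) • g (ℓ⁻¹ • v)) =
      fun v => (fun y : Space => Real.fourierChar (-⟪y, ℓ • p⟫) • g y) (ℓ⁻¹ • v) := by
    funext v
    simp only [real_inner_smul_left, real_inner_smul_right]
    rw [← mul_assoc, mul_inv_cancel₀ hℓ.ne', one_mul]
  rw [h, Measure.integral_comp_inv_smul_of_nonneg volume
    (fun y : Space => Real.fourierChar (-⟪y, ℓ • p⟫) • g y) hℓ.le, finrank_euclideanSpace_fin]

/-- **Modulation**: `𝓕[𝐞(⟨·,k⟩) g](p) = 𝓕g(p - k)`. [folklore] -/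
theorem fourier_fourierChar_mul (g : Space → ℂ) (k p : Space) :
    𝓕 (fun x => (Real.fourierChar ⟪x, k⟫ : ℂ) * g x) p = 𝓕 g (p - k) := by
  rw [Real.fourier_eq, Real.fourier_eq]
  congr 1
  funext v
  rw [Circle.smul_def, Circle.smul_def, smul_eq_mul, smul_eq_mul, ← mul_assoc, ← Circle.coe_mul,
    ← AddChar.map_add_eq_mul, inner_sub_right]
  congr 3
  ring

/-- **Linearity**: `𝓕(g₁ - c g₂) = 𝓕g₁ - c𝓕g₂` for integrable `g₁, g₂`. [folklore] -/
theorem fourier_sub_const_mul {g₁ g₂ : Space → ℂ} (h₁ : Integrable g₁) (h₂ : Integrable g₂)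
    (c : ℂ) (p : Space) :
    𝓕 (fun x => g₁ x - c * g₂ x) p = 𝓕 g₁ p - c * 𝓕 g₂ p := by
  simp only [Real.fourier_eq]
  have i1 := (Real.fourierIntegral_convergent_iff p).2 h₁
  have i2 := (Real.fourierIntegral_convergent_iff p).2 h₂
  rw [← integral_const_mul, ← integral_sub i1 (i2.const_mul c)]
  congr 1
  funext v
  rw [Circle.smul_def, Circle.smul_def, Circle.smul_def, smul_eq_mul, smul_eq_mul, smul_eq_mul]
  ring

/-- **`𝓕(χ_0 Q_0 e_n)(p) = ℓ³ (φ(ℓp - K) - c φ(ℓp))`**, `φ = 𝓕χ`, `K = ℓk`, `k = n/L`,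
`c = ℓ⁻³∫_Λ e_n`. [cite: Fournais2020, (3.20), (3.23)] -/
theorem fourier_locProjQ_cellWave {χ : Space → ℝ} (hχ : IsLocalizationFunction χ) (hℓ : 0 < ℓ)
    (L : ℝ) (n : Fin 3 → ℤ) (p : Space) :
    𝓕 (fun x => (locFun χ ℓ 0 x : ℂ) * projQ ℓ 0 (cellWave L n) x) p =
      (ℓ ^ 3 : ℝ) •
        (𝓕 (fun x => (χ x : ℂ)) (ℓ • p - ℓ • (toLp 2 fun j => (n j : ℝ) / L : Space)) -
          (((ℓ ^ 3)⁻¹ : ℝ) • ∫ y in slidingBox ℓ 0, cellWave L n y) *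
            𝓕 (fun x => (χ x : ℂ)) (ℓ • p)) := by
  set k : Space := toLp 2 fun j => (n j : ℝ) / L
  set c : ℂ := ((ℓ ^ 3)⁻¹ : ℝ) • ∫ y in slidingBox ℓ 0, cellWave L n y
  have hf : (fun x => (locFun χ ℓ 0 x : ℂ) * projQ ℓ 0 (cellWave L n) x) =
      fun x => cellWave L n x * (χ (ℓ⁻¹ • x) : ℂ) - c * (χ (ℓ⁻¹ • x) : ℂ) := by
    funext x
    rw [locFun_mul_projQ_cellWave hχ hℓ]
    ring
  rw [hf, fourier_sub_const_mul (integrable_cellWave_mul_dilate hχ hℓ L n) (integrable_dilate hχ hℓ)]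
  have hmod : 𝓕 (fun x => cellWave L n x * (χ (ℓ⁻¹ • x) : ℂ)) p =
      𝓕 (fun x => (χ (ℓ⁻¹ • x) : ℂ)) (p - k) := by
    have : (fun x => cellWave L n x * (χ (ℓ⁻¹ • x) : ℂ)) =
        fun x => (Real.fourierChar ⟪x, k⟫ : ℂ) * (χ (ℓ⁻¹ • x) : ℂ) := by
      funext x; rw [cellWave_eq_fourierChar]
    rw [this, fourier_fourierChar_mul]
  rw [hmod, fourier_comp_inv_smul hℓ (fun x => (χ x : ℂ)) (p - k),
    fourier_comp_inv_smul hℓ (fun x => (χ x : ℂ)) p, smul_sub, smul_sub, mul_smul_comm]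

/-- `φ = 𝓕χ` is continuous. [folklore] -/
theorem continuous_fourier_ofReal {χ : Space → ℝ} (hχ : IsLocalizationFunction χ) :
    Continuous (𝓕 (fun x : Space => (χ x : ℂ))) :=
  continuous_fourier (Continuous.integrable_of_hasCompactSupport
    (Complex.continuous_ofReal.comp hχ.continuous) (hχ.hasCompactSupport.comp_left Complex.ofReal_zero))

/-- `ofReal` only sees the positive part. [folklore] -/
theorem ofReal_eq_ofReal_max (a : ℝ) : ENNReal.ofReal a = ENNReal.ofReal (max a 0) := by
  rcases le_total a 0 with h | h
  · rw [max_eq_right h, ENNReal.ofReal_of_nonpos h, ENNReal.ofReal_zero]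
  · rw [max_eq_left h]

/-- **Scaling of the Fourier part of `⟨e_n, T_0 e_n⟩`** ("reduce by scaling to `ℓ = 1`"):
`∫ (4π²p² - (sℓ)⁻²)₊ |𝓕(χ_0Q_0e_n)(p)|² dp = ℓ ∫ (4π²q² - s⁻²)₊ |φ(q-K) - cφ(q)|² dq`, written
with the factor `ℓ = (ℓ³)⁻¹ ℓ⁴`. [cite: Fournais2020, (3.20)–(3.23)] -/
theorem fourierPart_cellWave_eq {χ : Space → ℝ} (hχ : IsLocalizationFunction χ) (hℓ : 0 < ℓ)
    (L : ℝ) (n : Fin 3 → ℤ) (s : ℝ) :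
    ∫⁻ p, ENNReal.ofReal (4 * Real.pi ^ 2 * ‖p‖ ^ 2 - (s * ℓ)⁻¹ ^ 2) *
        (‖𝓕 (fun x => (locFun χ ℓ 0 x : ℂ) * projQ ℓ 0 (cellWave L n) x) p‖₊ : ℝ≥0∞) ^ 2 =
      (ENNReal.ofReal ℓ ^ 3)⁻¹ * (ENNReal.ofReal (ℓ ^ 4) *
        ∫⁻ q, ENNReal.ofReal (max (4 * Real.pi ^ 2 * ‖q‖ ^ 2 - s⁻¹ ^ 2) 0 *
          ‖𝓕 (fun x => (χ x : ℂ)) (q - ℓ • (toLp 2 fun j => (n j : ℝ) / L : Space)) -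
            (((ℓ ^ 3)⁻¹ : ℝ) • ∫ y in slidingBox ℓ 0, cellWave L n y) *
              𝓕 (fun x => (χ x : ℂ)) q‖ ^ 2)) := by
  set K : Space := ℓ • (toLp 2 fun j => (n j : ℝ) / L : Space)
  set c : ℂ := ((ℓ ^ 3)⁻¹ : ℝ) • ∫ y in slidingBox ℓ 0, cellWave L n y
  set φ : Space → ℂ := 𝓕 (fun x => (χ x : ℂ))
  have hφc : Continuous φ := continuous_fourier_ofReal hχ
  set H : Space → ℝ≥0∞ := fun q => ENNReal.ofReal (ℓ ^ 4) *
    ENNReal.ofReal (max (4 * Real.pi ^ 2 * ‖q‖ ^ 2 - s⁻¹ ^ 2) 0 * ‖φ (q - K) - c * φ q‖ ^ 2)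
  have hHm : Measurable fun q => ENNReal.ofReal
      (max (4 * Real.pi ^ 2 * ‖q‖ ^ 2 - s⁻¹ ^ 2) 0 * ‖φ (q - K) - c * φ q‖ ^ 2) := by
    refine Measurable.ennreal_ofReal (Continuous.measurable ?_)
    exact ((continuous_const.mul (continuous_norm.pow 2)).sub continuous_const).max
      continuous_const |>.mul (((hφc.comp (continuous_id.sub continuous_const)).sub
        (continuous_const.mul hφc)).norm.pow 2)
  have hH : Measurable H := hHm.const_mul _
  have hint : ∀ p : Space, ENNReal.ofReal (4 * Real.pi ^ 2 * ‖p‖ ^ 2 - (s * ℓ)⁻¹ ^ 2) *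
      (‖𝓕 (fun x => (locFun χ ℓ 0 x : ℂ) * projQ ℓ 0 (cellWave L n) x) p‖₊ : ℝ≥0∞) ^ 2 =
      H (ℓ • p) := by
    intro p
    rw [fourier_locProjQ_cellWave hχ hℓ, coe_nnnorm_sq_eq_ofReal, ofReal_eq_ofReal_max,
      ← ENNReal.ofReal_mul (le_max_right _ _)]
    simp only [H]
    rw [← ENNReal.ofReal_mul (by positivity)]
    congr 1
    rw [norm_smul, Real.norm_eq_abs, abs_of_pos (by positivity), mul_pow, norm_smul,
      Real.norm_eq_abs, abs_of_pos hℓ, mul_pow, show ℓ • p - K = ℓ • p - K from rfl]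
    have hmax : max (4 * Real.pi ^ 2 * ‖p‖ ^ 2 - (s * ℓ)⁻¹ ^ 2) 0 * ℓ ^ 2 =
        max (4 * Real.pi ^ 2 * (ℓ ^ 2 * ‖p‖ ^ 2) - s⁻¹ ^ 2) 0 := by
      rw [max_mul_of_nonneg _ _ (sq_nonneg ℓ), zero_mul]
      congr 1
      field_simp
    calc max (4 * Real.pi ^ 2 * ‖p‖ ^ 2 - (s * ℓ)⁻¹ ^ 2) 0 * ((ℓ ^ 3) ^ 2 * ‖φ (ℓ • p - K) - c * φ (ℓ • p)‖ ^ 2)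
        = ℓ ^ 4 * ((max (4 * Real.pi ^ 2 * ‖p‖ ^ 2 - (s * ℓ)⁻¹ ^ 2) 0 * ℓ ^ 2) *
            ‖φ (ℓ • p - K) - c * φ (ℓ • p)‖ ^ 2) := by ring
      _ = _ := by rw [hmax]
  simp_rw [hint]
  rw [lintegral_comp_smul hℓ hH]
  simp only [H]
  rw [lintegral_const_mul _ hHm]

/-- **The `Q`-part of `⟨e_n, T_0 e_n⟩`**: `‖Q_0 e_n‖² = ∫_Λ |e_n - c|² ≤ β ℓ³` whenever
`|e_n - c|² ≤ β` on `Λ`. [cite: Fournais2020, (3.22), (3.24)] -/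
theorem projQPart_cellWave_le (ℓ L : ℝ) (n : Fin 3 → ℤ) {β : ℝ}
    (hβ : ∀ x ∈ slidingBox ℓ 0,
      ‖cellWave L n x - ((ℓ ^ 3)⁻¹ : ℝ) • ∫ y in slidingBox ℓ 0, cellWave L n y‖ ^ 2 ≤ β) :
    ∫⁻ x, (‖projQ ℓ 0 (cellWave L n) x‖₊ : ℝ≥0∞) ^ 2 ≤ ENNReal.ofReal β * ENNReal.ofReal ℓ ^ 3 := by
  have hA := measurableSet_slidingBox ℓ 0
  set c : ℂ := ((ℓ ^ 3)⁻¹ : ℝ) • ∫ y in slidingBox ℓ 0, cellWave L n y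
  have h1 : ∫⁻ x, (‖projQ ℓ 0 (cellWave L n) x‖₊ : ℝ≥0∞) ^ 2 =
      ∫⁻ x in slidingBox ℓ 0, (‖cellWave L n x - c‖₊ : ℝ≥0∞) ^ 2 := by
    rw [← lintegral_indicator hA]
    refine lintegral_congr fun x => ?_
    unfold projQ
    by_cases hx : x ∈ slidingBox ℓ 0
    · rw [indicator_of_mem hx, indicator_of_mem hx]
    · rw [indicator_of_notMem hx, indicator_of_notMem hx]; simp
  rw [h1, ← volume_slidingBox ℓ 0, ← setLIntegral_const]
  refine setLIntegral_mono measurable_const fun x hx => ?_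
  rw [coe_nnnorm_sq_eq_ofReal]
  exact ENNReal.ofReal_le_ofReal (hβ x hx)

end FourierComputation

/-! ### Estimates for a Schwartz-type `φ` (applied below to `φ = 𝓕χ`) -/

section Estimates

variable {φ : Space → ℂ} {s : ℝ} {K : Space}

/-- In the large-`|K|` regime `|K| ≥ (4πs)⁻¹` one has `2π²K² ≥ ⅛s⁻²`. [cite: Fournais2020, (3.29)] -/
theorem inv_sq_div_eight_le (hs : 0 < s) (hK : (4 * Real.pi * s)⁻¹ ≤ ‖K‖) :
    s⁻¹ ^ 2 / 8 ≤ 2 * Real.pi ^ 2 * ‖K‖ ^ 2 := by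
  have h1 : (4 * Real.pi * s)⁻¹ ^ 2 ≤ ‖K‖ ^ 2 := pow_le_pow_left₀ (by positivity) hK 2
  have h2 : (4 * Real.pi * s)⁻¹ ^ 2 = s⁻¹ ^ 2 / (16 * Real.pi ^ 2) := by
    have hπ : Real.pi ≠ 0 := Real.pi_pos.ne'
    field_simp
    ring
  rw [h2, div_le_iff₀ (by positivity)] at h1
  nlinarith [h1]

/-- **`∫(4π²q²-s⁻²)₊|φ|² ≤ 16π⁴s²∫q⁴|φ|²`** (the multiplier lives where `2πs|q| ≥ 1`).
[cite: Fournais2020, (3.25)] -/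
theorem lintegral_tau_normSq_le (hs : 0 < s) (φ : Space → ℂ) :
    ∫⁻ q, ENNReal.ofReal (max (4 * Real.pi ^ 2 * ‖q‖ ^ 2 - s⁻¹ ^ 2) 0 * ‖φ q‖ ^ 2) ≤
      ENNReal.ofReal (16 * Real.pi ^ 4 * s ^ 2) *
        ∫⁻ q, ENNReal.ofReal (‖q‖ ^ 4 * ‖φ q‖ ^ 2) := by
  rw [← lintegral_const_mul' _ _ ENNReal.ofReal_ne_top]
  refine lintegral_mono fun q => ?_
  rw [← ENNReal.ofReal_mul (by positivity)]
  refine ENNReal.ofReal_le_ofReal ?_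
  calc max (4 * Real.pi ^ 2 * ‖q‖ ^ 2 - s⁻¹ ^ 2) 0 * ‖φ q‖ ^ 2
      ≤ 16 * Real.pi ^ 4 * s ^ 2 * ‖q‖ ^ 4 * ‖φ q‖ ^ 2 :=
        mul_le_mul_of_nonneg_right (tau_le_pow_four hs q) (sq_nonneg _)
    _ = _ := by ring

/-- `∫(4π²q²-s⁻²)₊|φ|² ≤ ∫4π²q²|φ|²`. [cite: Fournais2020, (3.26)] -/
theorem lintegral_tau_normSq_le' (s : ℝ) (φ : Space → ℂ) :
    ∫⁻ q, ENNReal.ofReal (max (4 * Real.pi ^ 2 * ‖q‖ ^ 2 - s⁻¹ ^ 2) 0 * ‖φ q‖ ^ 2) ≤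
      ∫⁻ q, ENNReal.ofReal (4 * Real.pi ^ 2 * ‖q‖ ^ 2 * ‖φ q‖ ^ 2) :=
  lintegral_mono fun q => ENNReal.ofReal_le_ofReal
    (mul_le_mul_of_nonneg_right (tau_le_sq s q) (sq_nonneg _))

/-- **The cross term `II`**: `∫(4π²q²-s⁻²)₊|φ(q-K)||φ(q)| ≤ ‖φ‖_∞ ∫4π²q²|φ|`.
[cite: Fournais2020, (3.26)] -/
theorem lintegral_tau_cross_le {C₀ : ℝ} (hC₀ : ∀ q, ‖φ q‖ ≤ C₀) (s : ℝ) (K : Space) :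
    ∫⁻ q, ENNReal.ofReal (max (4 * Real.pi ^ 2 * ‖q‖ ^ 2 - s⁻¹ ^ 2) 0 * (‖φ (q - K)‖ * ‖φ q‖)) ≤
      ENNReal.ofReal C₀ * ∫⁻ q, ENNReal.ofReal (4 * Real.pi ^ 2 * ‖q‖ ^ 2 * ‖φ q‖) := by
  have hC : 0 ≤ C₀ := (norm_nonneg _).trans (hC₀ 0)
  rw [← lintegral_const_mul' _ _ ENNReal.ofReal_ne_top]
  refine lintegral_mono fun q => ?_
  rw [← ENNReal.ofReal_mul hC]
  refine ENNReal.ofReal_le_ofReal ?_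
  have h1 := tau_le_sq s q
  have h2 := hC₀ (q - K)
  have h3 : 0 ≤ max (4 * Real.pi ^ 2 * ‖q‖ ^ 2 - s⁻¹ ^ 2) 0 := le_max_right _ _
  calc max (4 * Real.pi ^ 2 * ‖q‖ ^ 2 - s⁻¹ ^ 2) 0 * (‖φ (q - K)‖ * ‖φ q‖)
      ≤ 4 * Real.pi ^ 2 * ‖q‖ ^ 2 * (C₀ * ‖φ q‖) :=
        mul_le_mul h1 (mul_le_mul_of_nonneg_right h2 (norm_nonneg _))
          (mul_nonneg (norm_nonneg _) (norm_nonneg _)) (by positivity)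
    _ = C₀ * (4 * Real.pi ^ 2 * ‖q‖ ^ 2 * ‖φ q‖) := by ring

/-- On the segment `[q, q-K]` with `2|K| < |q|`, `|z| ≥ |q|/2`. [cite: Fournais2020, (3.25)] -/
theorem half_norm_le_of_mem_segment {q K z : Space} (h2K : 2 * ‖K‖ < ‖q‖)
    (hz : z ∈ segment ℝ q (q - K)) : ‖q‖ / 2 ≤ ‖z‖ := by
  rw [segment_eq_image'] at hz
  obtain ⟨t, ht, rfl⟩ := hz
  have heq : q + t • (q - K - q) = q - t • K := by
    rw [sub_sub_cancel_left, smul_neg, sub_eq_add_neg]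
  change ‖q‖ / 2 ≤ ‖q + t • (q - K - q)‖
  rw [heq]
  have htK : ‖t • K‖ ≤ ‖K‖ := by
    rw [norm_smul, Real.norm_eq_abs, abs_of_nonneg ht.1]
    exact mul_le_of_le_one_left (norm_nonneg _) ht.2
  have := norm_sub_norm_le q (t • K)
  linarith

/-- **The term `I` of the small-`|K|` regime** ((3.25), obtained by the mean value inequality):
for `|K| ≤ (4πs)⁻¹` and `|∇φ(z)| ≤ C₁(1+|z|)⁻⁴`,
`∫(4π²q²-s⁻²)₊|φ(q-K)-φ(q)|² ≤ 4096π⁴C₁² s²K² ∫(1+|q|)⁻⁴`. [cite: Fournais2020, (3.25)] -/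
theorem lintegral_tau_diff_le (hφd : Differentiable ℝ φ) {C₁ : ℝ} (hC₁ : 0 ≤ C₁)
    (hder : ∀ z, ‖fderiv ℝ φ z‖ ≤ C₁ / (1 + ‖z‖) ^ 4) (hs : 0 < s)
    (hK : ‖K‖ ≤ (4 * Real.pi * s)⁻¹) :
    ∫⁻ q, ENNReal.ofReal (max (4 * Real.pi ^ 2 * ‖q‖ ^ 2 - s⁻¹ ^ 2) 0 * ‖φ (q - K) - φ q‖ ^ 2) ≤
      ENNReal.ofReal (4096 * Real.pi ^ 4 * C₁ ^ 2 * s ^ 2 * ‖K‖ ^ 2) *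
        ∫⁻ q : Space, ENNReal.ofReal (((1 + ‖q‖) ^ 4)⁻¹) := by
  rw [← lintegral_const_mul' _ _ ENNReal.ofReal_ne_top]
  refine lintegral_mono fun q => ?_
  rw [← ENNReal.ofReal_mul (by positivity)]
  refine ENNReal.ofReal_le_ofReal ?_
  by_cases hq : max (4 * Real.pi ^ 2 * ‖q‖ ^ 2 - s⁻¹ ^ 2) 0 = 0
  · rw [hq, zero_mul]; positivity
  have hpos : 0 < max (4 * Real.pi ^ 2 * ‖q‖ ^ 2 - s⁻¹ ^ 2) 0 :=
    lt_of_le_of_ne (le_max_right _ _) (Ne.symm hq)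
  have h2K := two_mul_norm_lt_of_tau_pos hs hpos hK
  have hq1 : 0 < 1 + ‖q‖ := by positivity
  -- the derivative along the segment
  have hbound : ∀ z ∈ segment ℝ q (q - K), ‖fderiv ℝ φ z‖ ≤ 16 * C₁ / (1 + ‖q‖) ^ 4 := by
    intro z hz
    refine (hder z).trans ?_
    have hz := half_norm_le_of_mem_segment h2K hz
    have h1 : (1 + ‖q‖) / 2 ≤ 1 + ‖z‖ := by linarith [norm_nonneg q]
    have h2 : ((1 + ‖q‖) / 2) ^ 4 ≤ (1 + ‖z‖) ^ 4 := pow_le_pow_left₀ (by positivity) h1 4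
    rw [div_le_div_iff₀ (by positivity) (by positivity)]
    calc C₁ * (1 + ‖q‖) ^ 4 = C₁ * (16 * ((1 + ‖q‖) / 2) ^ 4) := by ring
      _ ≤ C₁ * (16 * (1 + ‖z‖) ^ 4) := by gcongr
      _ = 16 * C₁ * (1 + ‖z‖) ^ 4 := by ring
  have hmvt : ‖φ (q - K) - φ q‖ ≤ 16 * C₁ / (1 + ‖q‖) ^ 4 * ‖q - K - q‖ :=
    (convex_segment q (q - K)).norm_image_sub_le_of_norm_fderiv_le
      (fun z _ => hφd.differentiableAt) hbound (left_mem_segment ℝ q (q - K))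
      (right_mem_segment ℝ q (q - K))
  rw [sub_sub_cancel_left, norm_neg] at hmvt
  have htau := tau_le_pow_four hs q
  have hq4 : ‖q‖ ^ 4 ≤ (1 + ‖q‖) ^ 4 :=
    pow_le_pow_left₀ (norm_nonneg _) (by linarith [norm_nonneg q]) 4
  have hd : ‖φ (q - K) - φ q‖ ^ 2 ≤ (16 * C₁ / (1 + ‖q‖) ^ 4 * ‖K‖) ^ 2 :=
    pow_le_pow_left₀ (norm_nonneg _) hmvt 2
  have hne : (1 + ‖q‖) ^ 4 ≠ 0 := (pow_pos hq1 4).ne'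
  calc max (4 * Real.pi ^ 2 * ‖q‖ ^ 2 - s⁻¹ ^ 2) 0 * ‖φ (q - K) - φ q‖ ^ 2
      ≤ 16 * Real.pi ^ 4 * s ^ 2 * ‖q‖ ^ 4 * (16 * C₁ / (1 + ‖q‖) ^ 4 * ‖K‖) ^ 2 :=
        mul_le_mul htau hd (sq_nonneg _) (by positivity)
    _ ≤ 16 * Real.pi ^ 4 * s ^ 2 * (1 + ‖q‖) ^ 4 * (16 * C₁ / (1 + ‖q‖) ^ 4 * ‖K‖) ^ 2 := by
        gcongr
    _ = 4096 * Real.pi ^ 4 * C₁ ^ 2 * s ^ 2 * ‖K‖ ^ 2 * ((1 + ‖q‖) ^ 4)⁻¹ := by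
        field_simp
        ring

/-- `∫ ⟨q,K⟩|φ(q)|² dq = 0` for `|φ|` even. [cite: Fournais2020, (3.27)] -/
theorem integral_inner_mul_normSq_eq_zero (heven : ∀ q, ‖φ (-q)‖ = ‖φ q‖) (K : Space) :
    ∫ q, ⟪q, K⟫ * ‖φ q‖ ^ 2 = 0 := by
  have h := integral_neg_eq_self (fun q : Space => ⟪q, K⟫ * ‖φ q‖ ^ 2) volume
  simp only [inner_neg_left, heven, neg_mul, integral_neg] at h
  linarith

/-- `q ↦ ⟨q,K⟩|φ(q)|²` is integrable when `|φ|²` and `q²|φ|²` are. [folklore] -/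
theorem integrable_inner_mul_normSq (hφc : Continuous φ) (hφ2 : Integrable fun q => ‖φ q‖ ^ 2)
    (hφq2 : Integrable fun q : Space => ‖q‖ ^ 2 * ‖φ q‖ ^ 2) (K : Space) :
    Integrable fun q => ⟪q, K⟫ * ‖φ q‖ ^ 2 := by
  refine Integrable.mono' ((hφq2.add (hφ2.const_mul (‖K‖ ^ 2))).div_const 2)
    ((continuous_id.inner continuous_const).mul (hφc.norm.pow 2)).aestronglyMeasurable
    (ae_of_all _ fun q => ?_)
  rw [Real.norm_eq_abs, abs_mul, abs_of_nonneg (sq_nonneg ‖φ q‖)]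
  simp only [Pi.add_apply]
  have h1 := abs_real_inner_le_norm q K
  have h2 : ‖q‖ * ‖K‖ ≤ (‖q‖ ^ 2 + ‖K‖ ^ 2) / 2 := by nlinarith [sq_nonneg (‖q‖ - ‖K‖)]
  have h3 : 0 ≤ ‖φ q‖ ^ 2 := sq_nonneg _
  calc |⟪q, K⟫| * ‖φ q‖ ^ 2 ≤ (‖q‖ ^ 2 + ‖K‖ ^ 2) / 2 * ‖φ q‖ ^ 2 :=
        mul_le_mul_of_nonneg_right (h1.trans h2) h3
    _ = (‖q‖ ^ 2 * ‖φ q‖ ^ 2 + ‖K‖ ^ 2 * ‖φ q‖ ^ 2) / 2 := by ring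

/-- **The term `I` of the large-`|K|` regime** ((3.27)–(3.29) with `ε = ½`): for `|K| ≥ (4πs)⁻¹`,
`∫(4π²q²-s⁻²)₊|φ(q-K)|² ≤ 4π²K² - ⅛s⁻² + 2∫4π²q²|φ|²`, using `∫|φ|² = 1`, the parity of
`|φ|`, `(x)₊ = x + (-x)₊` and `(s⁻² - 4π²(q+K)²)₊ ≤ (s⁻² - 2π²K²)₊ + 4π²q² ≤ ⅞s⁻² + 4π²q²`.
[cite: Fournais2020, (3.27)–(3.29)] -/
theorem integral_tau_shift_normSq_le (hφc : Continuous φ) (hφ2 : Integrable fun q => ‖φ q‖ ^ 2)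
    (hφq2 : Integrable fun q : Space => ‖q‖ ^ 2 * ‖φ q‖ ^ 2) (hnorm : ∫ q, ‖φ q‖ ^ 2 = 1)
    (heven : ∀ q, ‖φ (-q)‖ = ‖φ q‖) (hs : 0 < s) (hK : (4 * Real.pi * s)⁻¹ ≤ ‖K‖) :
    ∫ q, max (4 * Real.pi ^ 2 * ‖q‖ ^ 2 - s⁻¹ ^ 2) 0 * ‖φ (q - K)‖ ^ 2 ≤
      4 * Real.pi ^ 2 * ‖K‖ ^ 2 - s⁻¹ ^ 2 / 8 +
        2 * ∫ q, 4 * Real.pi ^ 2 * ‖q‖ ^ 2 * ‖φ q‖ ^ 2 := by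
  -- shift `q ↦ q + K`
  have hshift : ∫ q, max (4 * Real.pi ^ 2 * ‖q‖ ^ 2 - s⁻¹ ^ 2) 0 * ‖φ (q - K)‖ ^ 2 =
      ∫ q, max (4 * Real.pi ^ 2 * ‖q + K‖ ^ 2 - s⁻¹ ^ 2) 0 * ‖φ q‖ ^ 2 := by
    rw [← integral_add_right_eq_self
      (fun q : Space => max (4 * Real.pi ^ 2 * ‖q‖ ^ 2 - s⁻¹ ^ 2) 0 * ‖φ (q - K)‖ ^ 2) K]
    simp only [add_sub_cancel_right]
  rw [hshift]
  have hK2 := inv_sq_div_eight_le hs hK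
  set C : ℝ := 4 * Real.pi ^ 2 * ‖K‖ ^ 2 - s⁻¹ ^ 2 / 8 with hC
  -- pointwise bound
  have hpt : ∀ q : Space, max (4 * Real.pi ^ 2 * ‖q + K‖ ^ 2 - s⁻¹ ^ 2) 0 * ‖φ q‖ ^ 2 ≤
      8 * Real.pi ^ 2 * (‖q‖ ^ 2 * ‖φ q‖ ^ 2) + 8 * Real.pi ^ 2 * (⟪q, K⟫ * ‖φ q‖ ^ 2) +
        C * ‖φ q‖ ^ 2 := by
    intro q
    have hexp : ‖q + K‖ ^ 2 = ‖q‖ ^ 2 + 2 * ⟪q, K⟫ + ‖K‖ ^ 2 := norm_add_sq_real q K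
    have hin := abs_le.1 (abs_real_inner_le_norm q K)
    have hlow : ‖K‖ ^ 2 / 2 - ‖q‖ ^ 2 ≤ ‖q + K‖ ^ 2 := by
      rw [hexp]; nlinarith [sq_nonneg (2 * ‖q‖ - ‖K‖), hin.1, norm_nonneg q, norm_nonneg K]
    have hmax : max (4 * Real.pi ^ 2 * ‖q + K‖ ^ 2 - s⁻¹ ^ 2) 0 ≤
        8 * Real.pi ^ 2 * ‖q‖ ^ 2 + 8 * Real.pi ^ 2 * ⟪q, K⟫ + C := by
      refine max_le ?_ ?_
      · rw [hexp, hC]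
        nlinarith [sq_nonneg ‖q‖, Real.pi_pos, sq_nonneg s⁻¹]
      · have : 8 * Real.pi ^ 2 * ‖q‖ ^ 2 + 8 * Real.pi ^ 2 * ⟪q, K⟫ + C =
            4 * Real.pi ^ 2 * ‖q + K‖ ^ 2 + 4 * Real.pi ^ 2 * ‖q‖ ^ 2 - s⁻¹ ^ 2 / 8 := by
          rw [hexp, hC]; ring
        rw [this]
        nlinarith [hlow, hK2, Real.pi_pos, sq_nonneg Real.pi]
    have := mul_le_mul_of_nonneg_right hmax (sq_nonneg ‖φ q‖)
    linarith
  -- integrability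
  have hcross := integrable_inner_mul_normSq hφc hφ2 hφq2 K
  have i1 : Integrable fun q : Space => 8 * Real.pi ^ 2 * (‖q‖ ^ 2 * ‖φ q‖ ^ 2) := hφq2.const_mul _
  have i2 : Integrable fun q : Space => 8 * Real.pi ^ 2 * (⟪q, K⟫ * ‖φ q‖ ^ 2) := hcross.const_mul _
  have i3 : Integrable fun q : Space => C * ‖φ q‖ ^ 2 := hφ2.const_mul _
  calc ∫ q, max (4 * Real.pi ^ 2 * ‖q + K‖ ^ 2 - s⁻¹ ^ 2) 0 * ‖φ q‖ ^ 2
      ≤ ∫ q, (8 * Real.pi ^ 2 * (‖q‖ ^ 2 * ‖φ q‖ ^ 2) + 8 * Real.pi ^ 2 * (⟪q, K⟫ * ‖φ q‖ ^ 2) +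
          C * ‖φ q‖ ^ 2) :=
        integral_mono_of_nonneg (ae_of_all _ fun q => by positivity) ((i1.fun_add i2).fun_add i3)
          (ae_of_all _ hpt)
    _ = 8 * Real.pi ^ 2 * (∫ q, ‖q‖ ^ 2 * ‖φ q‖ ^ 2) + 8 * Real.pi ^ 2 * (∫ q, ⟪q, K⟫ * ‖φ q‖ ^ 2) +
          C * ∫ q, ‖φ q‖ ^ 2 := by
        rw [integral_add (i1.fun_add i2) i3, integral_add i1 i2, integral_const_mul, integral_const_mul,
          integral_const_mul]
    _ = _ := by
        rw [integral_inner_mul_normSq_eq_zero heven, hnorm, hC]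
        have : ∫ q : Space, 4 * Real.pi ^ 2 * ‖q‖ ^ 2 * ‖φ q‖ ^ 2 =
            4 * Real.pi ^ 2 * ∫ q : Space, ‖q‖ ^ 2 * ‖φ q‖ ^ 2 := by
          rw [← integral_const_mul]
          congr 1; funext q; ring
        rw [this]
        ring

end Estimates

/-! ### The two regimes for `G₁(K) = ∫(4π²q²-s⁻²)₊|φ(q-K) - cφ(q)|²` -/

section Regimes

variable {φ : Space → ℂ} {s : ℝ} {K : Space}

/-- `∫⁻ ofReal (a f) = ofReal a · ∫⁻ ofReal f` for `a ≥ 0`. [folklore] -/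
theorem lintegral_ofReal_const_mul {a : ℝ} (ha : 0 ≤ a) (f : Space → ℝ) :
    ∫⁻ q, ENNReal.ofReal (a * f q) = ENNReal.ofReal a * ∫⁻ q, ENNReal.ofReal (f q) := by
  simp_rw [ENNReal.ofReal_mul ha]
  exact lintegral_const_mul' _ _ ENNReal.ofReal_ne_top

/-- `∫⁻ ofReal f = ofReal (∫ f)` for integrable `f ≥ 0`. [folklore] -/
theorem lintegral_ofReal_eq_ofReal_integral {f : Space → ℝ} (hf : Integrable f) (h0 : ∀ q, 0 ≤ f q) :
    ∫⁻ q, ENNReal.ofReal (f q) = ENNReal.ofReal (∫ q, f q) :=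
  (ofReal_integral_eq_lintegral_ofReal hf (ae_of_all _ h0)).symm

/-- The shifted main term is integrable. [folklore] -/
theorem integrable_tau_shift_normSq (hφc : Continuous φ) (hφ2 : Integrable fun q => ‖φ q‖ ^ 2)
    (hφq2 : Integrable fun q : Space => ‖q‖ ^ 2 * ‖φ q‖ ^ 2) (s : ℝ) (K : Space) :
    Integrable fun q : Space =>
      max (4 * Real.pi ^ 2 * ‖q‖ ^ 2 - s⁻¹ ^ 2) 0 * ‖φ (q - K)‖ ^ 2 := by
  have hm : Integrable fun q : Space => 8 * Real.pi ^ 2 * (‖q - K‖ ^ 2 * ‖φ (q - K)‖ ^ 2) +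
      8 * Real.pi ^ 2 * ‖K‖ ^ 2 * ‖φ (q - K)‖ ^ 2 :=
    ((hφq2.comp_sub_right K).const_mul _).fun_add ((hφ2.comp_sub_right K).const_mul _)
  refine hm.mono' ?_ (ae_of_all _ fun q => ?_)
  · exact ((((continuous_const.mul (continuous_norm.pow 2)).sub continuous_const).max
      continuous_const).mul ((hφc.comp (continuous_id.sub continuous_const)).norm.pow 2)
        ).aestronglyMeasurable
  · rw [Real.norm_eq_abs, abs_of_nonneg (by positivity)]
    have h1 := tau_le_sq s q
    have hq : ‖q‖ ≤ ‖q - K‖ + ‖K‖ := by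
      have := norm_add_le (q - K) K
      rwa [sub_add_cancel] at this
    have hq2 : ‖q‖ ^ 2 ≤ 2 * ‖q - K‖ ^ 2 + 2 * ‖K‖ ^ 2 := by
      nlinarith [sq_nonneg (‖q - K‖ - ‖K‖), norm_nonneg (q - K), norm_nonneg K, norm_nonneg q]
    have h3 : 0 ≤ ‖φ (q - K)‖ ^ 2 := sq_nonneg _
    calc max (4 * Real.pi ^ 2 * ‖q‖ ^ 2 - s⁻¹ ^ 2) 0 * ‖φ (q - K)‖ ^ 2
        ≤ 4 * Real.pi ^ 2 * ‖q‖ ^ 2 * ‖φ (q - K)‖ ^ 2 := mul_le_mul_of_nonneg_right h1 h3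
      _ ≤ 4 * Real.pi ^ 2 * (2 * ‖q - K‖ ^ 2 + 2 * ‖K‖ ^ 2) * ‖φ (q - K)‖ ^ 2 := by gcongr
      _ = _ := by ring

/-- **Large `|K|`** ((3.26)–(3.29)): for `|K| ≥ (4πs)⁻¹` and `|c| ≤ 1`,
`G₁(K) ≤ 4π²K² - ⅛s⁻² + 3∫4π²q²|φ|² + 2‖φ‖_∞∫4π²q²|φ|`. [cite: Fournais2020, (3.26)–(3.29)] -/
theorem lintegral_G1_le_large (hφc : Continuous φ) {C₀ : ℝ} (hC₀ : ∀ q, ‖φ q‖ ≤ C₀)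
    (hφ2 : Integrable fun q => ‖φ q‖ ^ 2) (hφq2 : Integrable fun q : Space => ‖q‖ ^ 2 * ‖φ q‖ ^ 2)
    (hφq1 : Integrable fun q : Space => ‖q‖ ^ 2 * ‖φ q‖)
    (hnorm : ∫ q, ‖φ q‖ ^ 2 = 1) (heven : ∀ q, ‖φ (-q)‖ = ‖φ q‖) (hs : 0 < s)
    (hK : (4 * Real.pi * s)⁻¹ ≤ ‖K‖) {c : ℂ} (hc : ‖c‖ ≤ 1) :
    ∫⁻ q, ENNReal.ofReal (max (4 * Real.pi ^ 2 * ‖q‖ ^ 2 - s⁻¹ ^ 2) 0 * ‖φ (q - K) - c * φ q‖ ^ 2) ≤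
      ENNReal.ofReal (4 * Real.pi ^ 2 * ‖K‖ ^ 2 - s⁻¹ ^ 2 / 8 +
        3 * (∫ q : Space, 4 * Real.pi ^ 2 * ‖q‖ ^ 2 * ‖φ q‖ ^ 2) +
        2 * C₀ * ∫ q : Space, 4 * Real.pi ^ 2 * ‖q‖ ^ 2 * ‖φ q‖) := by
  set D : ℝ := ∫ q : Space, 4 * Real.pi ^ 2 * ‖q‖ ^ 2 * ‖φ q‖ ^ 2 with hD
  set M : ℝ := ∫ q : Space, 4 * Real.pi ^ 2 * ‖q‖ ^ 2 * ‖φ q‖ with hM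
  have hD0 : 0 ≤ D := integral_nonneg fun q => by positivity
  have hM0 : 0 ≤ M := integral_nonneg fun q => by positivity
  have hC0' : 0 ≤ C₀ := (norm_nonneg _).trans (hC₀ 0)
  have hK2 := inv_sq_div_eight_le hs hK
  have hτ0 : ∀ q : Space, 0 ≤ max (4 * Real.pi ^ 2 * ‖q‖ ^ 2 - s⁻¹ ^ 2) 0 := fun q => le_max_right _ _
  -- pointwise: `|a - cb|² ≤ |a|² + 2|a||b| + |b|²`
  have hpt : ∀ q : Space,
      max (4 * Real.pi ^ 2 * ‖q‖ ^ 2 - s⁻¹ ^ 2) 0 * ‖φ (q - K) - c * φ q‖ ^ 2 ≤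
      max (4 * Real.pi ^ 2 * ‖q‖ ^ 2 - s⁻¹ ^ 2) 0 * ‖φ (q - K)‖ ^ 2 +
        2 * (max (4 * Real.pi ^ 2 * ‖q‖ ^ 2 - s⁻¹ ^ 2) 0 * (‖φ (q - K)‖ * ‖φ q‖)) +
        max (4 * Real.pi ^ 2 * ‖q‖ ^ 2 - s⁻¹ ^ 2) 0 * ‖φ q‖ ^ 2 := by
    intro q
    have h1 : ‖φ (q - K) - c * φ q‖ ≤ ‖φ (q - K)‖ + ‖φ q‖ := by
      refine (norm_sub_le _ _).trans ?_
      rw [norm_mul]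
      nlinarith [norm_nonneg (φ q), norm_nonneg c]
    have h2 : ‖φ (q - K) - c * φ q‖ ^ 2 ≤ (‖φ (q - K)‖ + ‖φ q‖) ^ 2 :=
      pow_le_pow_left₀ (norm_nonneg _) h1 2
    have := mul_le_mul_of_nonneg_left h2 (hτ0 q)
    nlinarith [this]
  -- integrability and the real values of the three terms
  have hIint := integrable_tau_shift_normSq hφc hφ2 hφq2 s K
  have hDint : Integrable fun q : Space => 4 * Real.pi ^ 2 * ‖q‖ ^ 2 * ‖φ q‖ ^ 2 :=
    (hφq2.const_mul (4 * Real.pi ^ 2)).congr (ae_of_all _ fun q => by ring)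
  have hMint : Integrable fun q : Space => 4 * Real.pi ^ 2 * ‖q‖ ^ 2 * ‖φ q‖ :=
    (hφq1.const_mul (4 * Real.pi ^ 2)).congr (ae_of_all _ fun q => by ring)
  have h1 : ∫⁻ q, ENNReal.ofReal (max (4 * Real.pi ^ 2 * ‖q‖ ^ 2 - s⁻¹ ^ 2) 0 * ‖φ (q - K)‖ ^ 2) ≤
      ENNReal.ofReal (4 * Real.pi ^ 2 * ‖K‖ ^ 2 - s⁻¹ ^ 2 / 8 + 2 * D) := by
    rw [lintegral_ofReal_eq_ofReal_integral hIint fun q => mul_nonneg (hτ0 q) (sq_nonneg _)]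
    exact ENNReal.ofReal_le_ofReal (integral_tau_shift_normSq_le hφc hφ2 hφq2 hnorm heven hs hK)
  have h2 : ∫⁻ q, ENNReal.ofReal
      (2 * (max (4 * Real.pi ^ 2 * ‖q‖ ^ 2 - s⁻¹ ^ 2) 0 * (‖φ (q - K)‖ * ‖φ q‖))) ≤
      ENNReal.ofReal (2 * C₀ * M) := by
    rw [lintegral_ofReal_const_mul zero_le_two, mul_assoc, ENNReal.ofReal_mul (p := 2) zero_le_two,
      ENNReal.ofReal_mul (p := C₀) hC0', hM,
      ← lintegral_ofReal_eq_ofReal_integral hMint fun q => by positivity]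
    exact mul_le_mul_right (lintegral_tau_cross_le hC₀ s K) _
  have h3 : ∫⁻ q, ENNReal.ofReal (max (4 * Real.pi ^ 2 * ‖q‖ ^ 2 - s⁻¹ ^ 2) 0 * ‖φ q‖ ^ 2) ≤
      ENNReal.ofReal D := by
    rw [hD, ← lintegral_ofReal_eq_ofReal_integral hDint fun q => by positivity]
    exact lintegral_tau_normSq_le' s φ
  have hmeas2 : Measurable fun q : Space => ENNReal.ofReal
      (2 * (max (4 * Real.pi ^ 2 * ‖q‖ ^ 2 - s⁻¹ ^ 2) 0 * (‖φ (q - K)‖ * ‖φ q‖))) :=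
    (continuous_const.mul ((((continuous_const.mul (continuous_norm.pow 2)).sub
      continuous_const).max continuous_const).mul
      ((hφc.comp (continuous_id.sub continuous_const)).norm.mul hφc.norm))).measurable.ennreal_ofReal
  have hmeas3 : Measurable fun q : Space => ENNReal.ofReal
      (max (4 * Real.pi ^ 2 * ‖q‖ ^ 2 - s⁻¹ ^ 2) 0 * ‖φ q‖ ^ 2) :=
    ((((continuous_const.mul (continuous_norm.pow 2)).sub continuous_const).max
      continuous_const).mul (hφc.norm.pow 2)).measurable.ennreal_ofReal
  have hpos1 : 0 ≤ 4 * Real.pi ^ 2 * ‖K‖ ^ 2 - s⁻¹ ^ 2 / 8 + 2 * D := by nlinarith [hK2, hD0]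
  calc ∫⁻ q, ENNReal.ofReal (max (4 * Real.pi ^ 2 * ‖q‖ ^ 2 - s⁻¹ ^ 2) 0 * ‖φ (q - K) - c * φ q‖ ^ 2)
      ≤ ∫⁻ q, (ENNReal.ofReal (max (4 * Real.pi ^ 2 * ‖q‖ ^ 2 - s⁻¹ ^ 2) 0 * ‖φ (q - K)‖ ^ 2) +
          ENNReal.ofReal (2 * (max (4 * Real.pi ^ 2 * ‖q‖ ^ 2 - s⁻¹ ^ 2) 0 * (‖φ (q - K)‖ * ‖φ q‖))) +
          ENNReal.ofReal (max (4 * Real.pi ^ 2 * ‖q‖ ^ 2 - s⁻¹ ^ 2) 0 * ‖φ q‖ ^ 2)) := by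
        refine lintegral_mono fun q => ?_
        rw [← ENNReal.ofReal_add (mul_nonneg (hτ0 q) (sq_nonneg _))
            (mul_nonneg zero_le_two (mul_nonneg (hτ0 q) (mul_nonneg (norm_nonneg _) (norm_nonneg _)))),
          ← ENNReal.ofReal_add (add_nonneg (mul_nonneg (hτ0 q) (sq_nonneg _))
            (mul_nonneg zero_le_two (mul_nonneg (hτ0 q) (mul_nonneg (norm_nonneg _) (norm_nonneg _)))))
            (mul_nonneg (hτ0 q) (sq_nonneg _))]
        exact ENNReal.ofReal_le_ofReal (hpt q)
    _ = (∫⁻ q, ENNReal.ofReal (max (4 * Real.pi ^ 2 * ‖q‖ ^ 2 - s⁻¹ ^ 2) 0 * ‖φ (q - K)‖ ^ 2)) +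
          (∫⁻ q, ENNReal.ofReal
            (2 * (max (4 * Real.pi ^ 2 * ‖q‖ ^ 2 - s⁻¹ ^ 2) 0 * (‖φ (q - K)‖ * ‖φ q‖)))) +
          ∫⁻ q, ENNReal.ofReal (max (4 * Real.pi ^ 2 * ‖q‖ ^ 2 - s⁻¹ ^ 2) 0 * ‖φ q‖ ^ 2) := by
        rw [lintegral_add_right _ hmeas3, lintegral_add_right _ hmeas2]
    _ ≤ ENNReal.ofReal (4 * Real.pi ^ 2 * ‖K‖ ^ 2 - s⁻¹ ^ 2 / 8 + 2 * D) +
          ENNReal.ofReal (2 * C₀ * M) + ENNReal.ofReal D := add_le_add (add_le_add h1 h2) h3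
    _ = _ := by
        have h2M : 0 ≤ 2 * C₀ * M := mul_nonneg (mul_nonneg zero_le_two hC0') hM0
        rw [← ENNReal.ofReal_add hpos1 h2M, ← ENNReal.ofReal_add (add_nonneg hpos1 h2M) hD0]
        congr 1
        ring

/-- **Small `|K|`** ((3.24)–(3.25)): for `|K| ≤ (4πs)⁻¹`, `|1 - c| ≤ γ|K|` and
`|∇φ(z)| ≤ C₁(1+|z|)⁻⁴`,
`G₁(K) ≤ (8192π⁴C₁²∫(1+|q|)⁻⁴ + 32π⁴γ²∫q⁴|φ|²) s²K²`. [cite: Fournais2020, (3.24)–(3.25)] -/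
theorem lintegral_G1_le_small (hφc : Continuous φ) (hφd : Differentiable ℝ φ) {C₁ : ℝ}
    (hC₁ : 0 ≤ C₁) (hder : ∀ z, ‖fderiv ℝ φ z‖ ≤ C₁ / (1 + ‖z‖) ^ 4)
    (hφq4 : Integrable fun q : Space => ‖q‖ ^ 4 * ‖φ q‖ ^ 2)
    (hJ : Integrable fun q : Space => ((1 + ‖q‖) ^ 4)⁻¹)
    (hs : 0 < s) (hK : ‖K‖ ≤ (4 * Real.pi * s)⁻¹) {c : ℂ} {γ : ℝ}
    (hc : ‖1 - c‖ ≤ γ * ‖K‖) :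
    ∫⁻ q, ENNReal.ofReal (max (4 * Real.pi ^ 2 * ‖q‖ ^ 2 - s⁻¹ ^ 2) 0 * ‖φ (q - K) - c * φ q‖ ^ 2) ≤
      ENNReal.ofReal ((2 * (4096 * Real.pi ^ 4 * C₁ ^ 2 * ∫ q : Space, ((1 + ‖q‖) ^ 4)⁻¹) +
        2 * γ ^ 2 * (16 * Real.pi ^ 4) * ∫ q : Space, ‖q‖ ^ 4 * ‖φ q‖ ^ 2) * (s ^ 2 * ‖K‖ ^ 2)) := by
  set J : ℝ := ∫ q : Space, ((1 + ‖q‖) ^ 4)⁻¹ with hJdef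
  set C₄ : ℝ := ∫ q : Space, ‖q‖ ^ 4 * ‖φ q‖ ^ 2 with hC₄
  have hJ0 : 0 ≤ J := integral_nonneg fun q => by positivity
  have hC₄0 : 0 ≤ C₄ := integral_nonneg fun q => by positivity
  have hτ0 : ∀ q : Space, 0 ≤ max (4 * Real.pi ^ 2 * ‖q‖ ^ 2 - s⁻¹ ^ 2) 0 := fun q => le_max_right _ _
  have hc2 : ‖1 - c‖ ^ 2 ≤ (γ * ‖K‖) ^ 2 := pow_le_pow_left₀ (norm_nonneg _) hc 2
  -- pointwise: `|a - cb|² ≤ 2|a - b|² + 2|1-c|²|b|²`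
  have hpt : ∀ q : Space,
      max (4 * Real.pi ^ 2 * ‖q‖ ^ 2 - s⁻¹ ^ 2) 0 * ‖φ (q - K) - c * φ q‖ ^ 2 ≤
      2 * (max (4 * Real.pi ^ 2 * ‖q‖ ^ 2 - s⁻¹ ^ 2) 0 * ‖φ (q - K) - φ q‖ ^ 2) +
        2 * ‖1 - c‖ ^ 2 * (max (4 * Real.pi ^ 2 * ‖q‖ ^ 2 - s⁻¹ ^ 2) 0 * ‖φ q‖ ^ 2) := by
    intro q
    have heq : φ (q - K) - c * φ q = (φ (q - K) - φ q) + (1 - c) * φ q := by ring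
    have h1 : ‖φ (q - K) - c * φ q‖ ≤ ‖φ (q - K) - φ q‖ + ‖1 - c‖ * ‖φ q‖ := by
      rw [heq]
      exact (norm_add_le _ _).trans (by rw [norm_mul])
    have h2 : ‖φ (q - K) - c * φ q‖ ^ 2 ≤ (‖φ (q - K) - φ q‖ + ‖1 - c‖ * ‖φ q‖) ^ 2 :=
      pow_le_pow_left₀ (norm_nonneg _) h1 2
    have h3 : (‖φ (q - K) - φ q‖ + ‖1 - c‖ * ‖φ q‖) ^ 2 ≤
        2 * ‖φ (q - K) - φ q‖ ^ 2 + 2 * ‖1 - c‖ ^ 2 * ‖φ q‖ ^ 2 := by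
      nlinarith [sq_nonneg (‖φ (q - K) - φ q‖ - ‖1 - c‖ * ‖φ q‖)]
    have := mul_le_mul_of_nonneg_left (h2.trans h3) (hτ0 q)
    nlinarith [this]
  have hA : ∫⁻ q, ENNReal.ofReal
      (2 * (max (4 * Real.pi ^ 2 * ‖q‖ ^ 2 - s⁻¹ ^ 2) 0 * ‖φ (q - K) - φ q‖ ^ 2)) ≤
      ENNReal.ofReal (2 * (4096 * Real.pi ^ 4 * C₁ ^ 2 * s ^ 2 * ‖K‖ ^ 2 * J)) := by
    rw [lintegral_ofReal_const_mul zero_le_two, ENNReal.ofReal_mul (p := 2) zero_le_two,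
      ENNReal.ofReal_mul (p := 4096 * Real.pi ^ 4 * C₁ ^ 2 * s ^ 2 * ‖K‖ ^ 2) (by positivity), hJdef,
      ← lintegral_ofReal_eq_ofReal_integral hJ fun q => by positivity]
    exact mul_le_mul_right (lintegral_tau_diff_le hφd hC₁ hder hs hK) _
  have hT : ∫⁻ q, ENNReal.ofReal
      (2 * ‖1 - c‖ ^ 2 * (max (4 * Real.pi ^ 2 * ‖q‖ ^ 2 - s⁻¹ ^ 2) 0 * ‖φ q‖ ^ 2)) ≤
      ENNReal.ofReal (2 * (γ * ‖K‖) ^ 2 * (16 * Real.pi ^ 4 * s ^ 2 * C₄)) := by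
    rw [lintegral_ofReal_const_mul (a := 2 * ‖1 - c‖ ^ 2) (by positivity),
      ENNReal.ofReal_mul (p := 2 * (γ * ‖K‖) ^ 2) (by positivity),
      ENNReal.ofReal_mul (p := 16 * Real.pi ^ 4 * s ^ 2) (by positivity), hC₄,
      ← lintegral_ofReal_eq_ofReal_integral hφq4 fun q => by positivity]
    exact mul_le_mul' (ENNReal.ofReal_le_ofReal (by nlinarith [hc2])) (lintegral_tau_normSq_le hs φ)
  have hmeasT : Measurable fun q : Space => ENNReal.ofReal
      (2 * ‖1 - c‖ ^ 2 * (max (4 * Real.pi ^ 2 * ‖q‖ ^ 2 - s⁻¹ ^ 2) 0 * ‖φ q‖ ^ 2)) :=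
    (continuous_const.mul ((((continuous_const.mul (continuous_norm.pow 2)).sub
      continuous_const).max continuous_const).mul (hφc.norm.pow 2))).measurable.ennreal_ofReal
  calc ∫⁻ q, ENNReal.ofReal (max (4 * Real.pi ^ 2 * ‖q‖ ^ 2 - s⁻¹ ^ 2) 0 * ‖φ (q - K) - c * φ q‖ ^ 2)
      ≤ ∫⁻ q, (ENNReal.ofReal
            (2 * (max (4 * Real.pi ^ 2 * ‖q‖ ^ 2 - s⁻¹ ^ 2) 0 * ‖φ (q - K) - φ q‖ ^ 2)) +
          ENNReal.ofReal
            (2 * ‖1 - c‖ ^ 2 * (max (4 * Real.pi ^ 2 * ‖q‖ ^ 2 - s⁻¹ ^ 2) 0 * ‖φ q‖ ^ 2))) := by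
        refine lintegral_mono fun q => ?_
        rw [← ENNReal.ofReal_add (mul_nonneg zero_le_two (mul_nonneg (hτ0 q) (sq_nonneg _)))
          (mul_nonneg (mul_nonneg zero_le_two (sq_nonneg _)) (mul_nonneg (hτ0 q) (sq_nonneg _)))]
        exact ENNReal.ofReal_le_ofReal (hpt q)
    _ = (∫⁻ q, ENNReal.ofReal
            (2 * (max (4 * Real.pi ^ 2 * ‖q‖ ^ 2 - s⁻¹ ^ 2) 0 * ‖φ (q - K) - φ q‖ ^ 2))) +
          ∫⁻ q, ENNReal.ofReal
            (2 * ‖1 - c‖ ^ 2 * (max (4 * Real.pi ^ 2 * ‖q‖ ^ 2 - s⁻¹ ^ 2) 0 * ‖φ q‖ ^ 2)) :=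
        lintegral_add_right _ hmeasT
    _ ≤ ENNReal.ofReal (2 * (4096 * Real.pi ^ 4 * C₁ ^ 2 * s ^ 2 * ‖K‖ ^ 2 * J)) +
          ENNReal.ofReal (2 * (γ * ‖K‖) ^ 2 * (16 * Real.pi ^ 4 * s ^ 2 * C₄)) := add_le_add hA hT
    _ = _ := by
        have hx : 0 ≤ 2 * (4096 * Real.pi ^ 4 * C₁ ^ 2 * s ^ 2 * ‖K‖ ^ 2 * J) :=
          mul_nonneg zero_le_two (mul_nonneg (by positivity) hJ0)
        have hy : 0 ≤ 2 * (γ * ‖K‖) ^ 2 * (16 * Real.pi ^ 4 * s ^ 2 * C₄) :=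
          mul_nonneg (by positivity) (mul_nonneg (by positivity) hC₄0)
        rw [← ENNReal.ofReal_add hx hy]
        congr 1
        ring

end Regimes

/-! ### `φ = 𝓕χ` is a Schwartz function: the constants of (3.24)–(3.29) -/

section SchwartzFacts

variable {χ : Space → ℝ}

/-- `χ ∈ C_c^∞(ℝ³)` (complexified) is a Schwartz function. [folklore] -/
theorem exists_schwartzMap_coe (hχ : IsLocalizationFunction χ) :
    ∃ f : 𝓢(Space, ℂ), (f : Space → ℂ) = fun x => (χ x : ℂ) :=
  ⟨(hχ.hasCompactSupport.comp_left Complex.ofReal_zero).toSchwartzMap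
    (Complex.ofRealCLM.contDiff.comp hχ.contDiff), rfl⟩

/-- `φ = 𝓕χ` is a Schwartz function. [folklore] -/
theorem exists_schwartzMap_fourier (hχ : IsLocalizationFunction χ) :
    ∃ f : 𝓢(Space, ℂ), (f : Space → ℂ) = 𝓕 (fun x => (χ x : ℂ)) := by
  obtain ⟨g, hg⟩ := exists_schwartzMap_coe hχ
  exact ⟨𝓕 g, by rw [SchwartzMap.fourier_coe, hg]⟩

/-- A Schwartz function is bounded. [folklore] -/
theorem exists_norm_le_of_schwartz (f : 𝓢(Space, ℂ)) : ∃ C₀ : ℝ, ∀ q, ‖f q‖ ≤ C₀ := by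
  obtain ⟨C, -, hC⟩ := f.decay 0 0
  exact ⟨C, fun q => by simpa [norm_iteratedFDeriv_zero] using hC q⟩

/-- The gradient of a Schwartz function decays like `(1+|z|)⁻⁴`. [folklore] -/
theorem exists_norm_fderiv_le_of_schwartz (f : 𝓢(Space, ℂ)) :
    ∃ C₁ : ℝ, 0 ≤ C₁ ∧ ∀ z, ‖fderiv ℝ f z‖ ≤ C₁ / (1 + ‖z‖) ^ 4 := by
  refine ⟨2 ^ (4, 1).1 * (Finset.Iic (4, 1)).sup (fun m => SchwartzMap.seminorm ℝ m.1 m.2) f,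
    by positivity, fun z => ?_⟩
  have h := SchwartzMap.one_add_le_sup_seminorm_apply (𝕜 := ℝ) (m := (4, 1)) (k := 4) (n := 1)
    le_rfl le_rfl f z
  rw [norm_iteratedFDeriv_one] at h
  rw [le_div_iff₀ (by positivity), mul_comm]
  exact h

/-- `|q|ᵏ|f(q)|²` is integrable for a Schwartz function `f`. [folklore] -/
theorem integrable_pow_mul_normSq_of_schwartz (f : 𝓢(Space, ℂ)) (k : ℕ) :
    Integrable fun q : Space => ‖q‖ ^ k * ‖f q‖ ^ 2 := by
  obtain ⟨C₀, hC₀⟩ := exists_norm_le_of_schwartz f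
  have hC : 0 ≤ C₀ := (norm_nonneg _).trans (hC₀ 0)
  refine ((f.integrable_pow_mul volume k).const_mul C₀).mono' ?_ (ae_of_all _ fun q => ?_)
  · exact ((continuous_norm.pow k).mul (f.continuous.norm.pow 2)).aestronglyMeasurable
  · rw [Real.norm_eq_abs, abs_of_nonneg (by positivity)]
    calc ‖q‖ ^ k * ‖f q‖ ^ 2 = ‖f q‖ * (‖q‖ ^ k * ‖f q‖) := by ring
      _ ≤ C₀ * (‖q‖ ^ k * ‖f q‖) := mul_le_mul_of_nonneg_right (hC₀ q) (by positivity)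

/-- `|f|²` is integrable for a Schwartz function `f`. [folklore] -/
theorem integrable_normSq_of_schwartz (f : 𝓢(Space, ℂ)) :
    Integrable fun q : Space => ‖f q‖ ^ 2 := by
  simpa using integrable_pow_mul_normSq_of_schwartz f 0

/-- `(1+|q|)⁻⁴` is integrable on `ℝ³`. [folklore] -/
theorem integrable_inv_one_add_norm_pow_four :
    Integrable fun q : Space => ((1 + ‖q‖) ^ 4)⁻¹ := by
  have h := integrable_one_add_norm (E := Space) (μ := volume) (r := 4)
    (by rw [finrank_euclideanSpace_fin]; norm_num)
  refine h.congr (ae_of_all _ fun q => ?_)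
  change (1 + ‖q‖) ^ (-(4 : ℝ)) = ((1 + ‖q‖) ^ 4)⁻¹
  rw [Real.rpow_neg (by positivity), show (4 : ℝ) = ((4 : ℕ) : ℝ) by norm_num, Real.rpow_natCast]

/-- **Plancherel**: `∫|𝓕χ|² = ∫χ² = 1`. [cite: Fournais2020, (3.27)] -/
theorem integral_normSq_fourier_eq_one (hχ : IsLocalizationFunction χ) :
    ∫ q, ‖𝓕 (fun x => (χ x : ℂ)) q‖ ^ 2 = 1 := by
  obtain ⟨g, hg⟩ := exists_schwartzMap_coe hχ
  rw [← hg, ← SchwartzMap.fourier_coe, SchwartzMap.integral_norm_sq_fourier, hg]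
  simp only [Complex.norm_real, Real.norm_eq_abs, sq_abs]
  exact hχ.integral_sq

/-- `𝓕χ` is even for `χ` even. [cite: Fournais2020, (3.27)] -/
theorem fourier_neg_of_even (hχe : ∀ x, χ (-x) = χ x) (p : Space) :
    𝓕 (fun x => (χ x : ℂ)) (-p) = 𝓕 (fun x => (χ x : ℂ)) p := by
  rw [← Real.fourierInv_eq_fourier_neg, Real.fourierInv_eq_fourier_comp_neg]
  simp only [hχe]

/-- `e_n(0) = 1`. [folklore] -/
theorem cellWave_apply_zero (L : ℝ) (n : Fin 3 → ℤ) : cellWave L n 0 = 1 := by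
  simp [cellWave_apply]

end SchwartzFacts

/-! ### Assembly: (3.21) and Lemma 3.3 -/

section Assembly

variable {χ : Space → ℝ} {ℓ L s b β : ℝ}

/-- `ofReal X + ofReal a + ofReal c ≤ ofReal T` from the real inequality, all terms non-negative.
[folklore] -/
theorem ofReal_add_three_le {X a c T : ℝ} (hX : 0 ≤ X) (ha : 0 ≤ a) (hc : 0 ≤ c)
    (h : X + a + c ≤ T) :
    ENNReal.ofReal X + ENNReal.ofReal a + ENNReal.ofReal c ≤ ENNReal.ofReal T := by
  rw [← ENNReal.ofReal_add hX ha, ← ENNReal.ofReal_add (add_nonneg hX ha) hc]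
  exact ENNReal.ofReal_le_ofReal h

/-- **Scaling to `ℓ = 1`** ((3.20)–(3.23)): `ℓ⁻³⟨e_n, T_0 e_n⟩ ≤ ℓ⁻²(G₁(K) + bβ)` whenever
`|e_n - c|² ≤ β` on `Λ(0)`, with `G₁(K) = ∫(4π²q²-s⁻²)₊|φ(q-K) - cφ(q)|²dq`, `φ = 𝓕χ`, `K = ℓn/L`.
[cite: Fournais2020, (3.20)–(3.23)] -/
theorem kinLoc_cellWave_le (hχ : IsLocalizationFunction χ) (hℓ : 0 < ℓ) (L : ℝ)
    (n : Fin 3 → ℤ) (s : ℝ) (hb : 0 ≤ b) (hβ0 : 0 ≤ β)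
    (hβ : ∀ x ∈ slidingBox ℓ 0,
      ‖cellWave L n x - ((ℓ ^ 3)⁻¹ : ℝ) • ∫ y in slidingBox ℓ 0, cellWave L n y‖ ^ 2 ≤ β) :
    (ENNReal.ofReal ℓ ^ 3)⁻¹ * kinLoc χ ℓ s b 0 (cellWave L n) ≤
      ENNReal.ofReal ((ℓ ^ 2)⁻¹) *
        ((∫⁻ q, ENNReal.ofReal (max (4 * Real.pi ^ 2 * ‖q‖ ^ 2 - s⁻¹ ^ 2) 0 *
            ‖𝓕 (fun x => (χ x : ℂ)) (q - ℓ • (toLp 2 fun j => (n j : ℝ) / L : Space)) -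
              (((ℓ ^ 3)⁻¹ : ℝ) • ∫ y in slidingBox ℓ 0, cellWave L n y) *
                𝓕 (fun x => (χ x : ℂ)) q‖ ^ 2)) +
          ENNReal.ofReal (b * β)) := by
  unfold kinLoc
  rw [fourierPart_cellWave_eq hχ hℓ L n s]
  have hQ := projQPart_cellWave_le ℓ L n hβ
  generalize (∫⁻ q, ENNReal.ofReal (max (4 * Real.pi ^ 2 * ‖q‖ ^ 2 - s⁻¹ ^ 2) 0 *
      ‖𝓕 (fun x => (χ x : ℂ)) (q - ℓ • (toLp 2 fun j => (n j : ℝ) / L : Space)) -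
        (((ℓ ^ 3)⁻¹ : ℝ) • ∫ y in slidingBox ℓ 0, cellWave L n y) *
          𝓕 (fun x => (χ x : ℂ)) q‖ ^ 2)) = G at hQ ⊢
  generalize (∫⁻ x, (‖projQ ℓ 0 (cellWave L n) x‖₊ : ℝ≥0∞) ^ 2) = QP at hQ ⊢
  have h3 : (ENNReal.ofReal ℓ ^ 3)⁻¹ = ENNReal.ofReal ((ℓ ^ 3)⁻¹) := by
    rw [← ENNReal.ofReal_pow hℓ.le, ENNReal.ofReal_inv_of_pos (pow_pos hℓ 3)]
  rw [h3, mul_add, mul_add]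
  refine add_le_add (le_of_eq ?_) ?_
  · rw [← mul_assoc, ← mul_assoc, ← ENNReal.ofReal_mul (by positivity),
      ← ENNReal.ofReal_mul (by positivity)]
    congr 1
    congr 1
    field_simp
  · calc ENNReal.ofReal ((ℓ ^ 3)⁻¹) * (ENNReal.ofReal (b / ℓ ^ 2) * QP)
        ≤ ENNReal.ofReal ((ℓ ^ 3)⁻¹) *
            (ENNReal.ofReal (b / ℓ ^ 2) * (ENNReal.ofReal β * ENNReal.ofReal ℓ ^ 3)) := by gcongr
      _ = ENNReal.ofReal ((ℓ ^ 2)⁻¹) * ENNReal.ofReal (b * β) := by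
          rw [← ENNReal.ofReal_pow hℓ.le, ← ENNReal.ofReal_mul hβ0,
            ← ENNReal.ofReal_mul (by positivity), ← ENNReal.ofReal_mul (by positivity),
            ← ENNReal.ofReal_mul (by positivity)]
          congr 1
          field_simp

/-- **Undoing the scaling**: from `G₁ + bβ + 2π²(ℓ/L)² ≤ 4π²K²` (`K = ℓn/L`) to (3.21) in the
vendored form `ℓ⁻³⟨e_n,T_0e_n⟩ + 2π²/L² ≤ 4π²|n|²/L²`. [cite: Fournais2020, (3.21)] -/
theorem eq321_of_reduced (hℓ : 0 < ℓ) (L : ℝ) (n : Fin 3 → ℤ) {G F : ℝ≥0∞}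
    (hkin : F ≤ ENNReal.ofReal ((ℓ ^ 2)⁻¹) * (G + ENNReal.ofReal (b * β)))
    (hred : G + ENNReal.ofReal (b * β) + ENNReal.ofReal (2 * Real.pi ^ 2 * (ℓ ^ 2 / L ^ 2)) ≤
      ENNReal.ofReal (4 * Real.pi ^ 2 * ‖ℓ • (toLp 2 fun j => (n j : ℝ) / L : Space)‖ ^ 2)) :
    F + ENNReal.ofReal (2 * Real.pi ^ 2 / L ^ 2) ≤
      ENNReal.ofReal (4 * Real.pi ^ 2 * (∑ j, (n j : ℝ) ^ 2) / L ^ 2) := by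
  have h2 : ENNReal.ofReal (2 * Real.pi ^ 2 / L ^ 2) =
      ENNReal.ofReal ((ℓ ^ 2)⁻¹) * ENNReal.ofReal (2 * Real.pi ^ 2 * (ℓ ^ 2 / L ^ 2)) := by
    rw [← ENNReal.ofReal_mul (by positivity)]
    congr 1
    field_simp
  have h4 : ENNReal.ofReal (4 * Real.pi ^ 2 * (∑ j, (n j : ℝ) ^ 2) / L ^ 2) =
      ENNReal.ofReal ((ℓ ^ 2)⁻¹) *
        ENNReal.ofReal (4 * Real.pi ^ 2 * ‖ℓ • (toLp 2 fun j => (n j : ℝ) / L : Space)‖ ^ 2) := by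
    rw [← ENNReal.ofReal_mul (by positivity), norm_sq_smul_waveVector]
    congr 1
    field_simp
  calc F + ENNReal.ofReal (2 * Real.pi ^ 2 / L ^ 2)
      ≤ ENNReal.ofReal ((ℓ ^ 2)⁻¹) * (G + ENNReal.ofReal (b * β)) +
          ENNReal.ofReal ((ℓ ^ 2)⁻¹) * ENNReal.ofReal (2 * Real.pi ^ 2 * (ℓ ^ 2 / L ^ 2)) := by
        rw [← h2]; gcongr
    _ = ENNReal.ofReal ((ℓ ^ 2)⁻¹) *
          (G + ENNReal.ofReal (b * β) + ENNReal.ofReal (2 * Real.pi ^ 2 * (ℓ ^ 2 / L ^ 2))) := by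
        rw [← mul_add]
    _ ≤ ENNReal.ofReal ((ℓ ^ 2)⁻¹) *
          ENNReal.ofReal (4 * Real.pi ^ 2 * ‖ℓ • (toLp 2 fun j => (n j : ℝ) / L : Space)‖ ^ 2) := by
        gcongr
    _ = _ := h4.symm

/-- `(ℓ/L)² ≤ |K|²` for `K = ℓn/L`, `n ≠ 0`. [cite: Fournais2020, (3.21)] -/
theorem sq_div_sq_le_norm_sq (ℓ : ℝ) {L : ℝ} (hL : 0 < L) {n : Fin 3 → ℤ} (hn : n ≠ 0) :
    ℓ ^ 2 / L ^ 2 ≤ ‖ℓ • (toLp 2 fun j => (n j : ℝ) / L : Space)‖ ^ 2 := by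
  rw [norm_sq_smul_waveVector]
  have h1 := one_le_sum_sq_of_ne_zero hn
  have hL2 : 0 < L ^ 2 := by positivity
  rw [div_le_div_iff_of_pos_right hL2]
  nlinarith [sq_nonneg ℓ]

/-- `2π²(ℓ/L)² ≤ π²/2` for `2ℓ < L`. [cite: Fournais2020, (3.21)] -/
theorem two_pi_sq_mul_le (hℓ : 0 < ℓ) (hL : 2 * ℓ < L) :
    2 * Real.pi ^ 2 * (ℓ ^ 2 / L ^ 2) ≤ Real.pi ^ 2 / 2 := by
  have hL0 : 0 < L := by linarith
  have h : ℓ ^ 2 / L ^ 2 ≤ 1 / 4 := by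
    rw [div_le_div_iff₀ (by positivity) (by norm_num)]
    nlinarith
  nlinarith [Real.pi_pos, sq_nonneg Real.pi]

/-- **Small `|K|`, conclusion** ((3.24)–(3.25) ⇒ (3.21)): if `G₁ ≤ A s²K²` with `As² ≤ 1`,
then `G₁ + (1/24)(γ|K|)² + 2π²(ℓ/L)² ≤ 4π²K²` (`γ² = 12π²`, `(ℓ/L)² ≤ K²`, `π² ≥ 4`).
[cite: Fournais2020, (3.21), (3.24)–(3.25)] -/
theorem reduced_of_small {G : ℝ≥0∞} {A s nK r γ : ℝ}
    (hG : G ≤ ENNReal.ofReal (A * (s ^ 2 * nK ^ 2))) (hA0 : 0 ≤ A) (hAs : A * s ^ 2 ≤ 1)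
    (hr0 : 0 ≤ r) (hr : r ≤ nK ^ 2) (hγ : γ ^ 2 = 12 * Real.pi ^ 2) :
    G + ENNReal.ofReal (1 / 24 * (γ * nK) ^ 2) + ENNReal.ofReal (2 * Real.pi ^ 2 * r) ≤
      ENNReal.ofReal (4 * Real.pi ^ 2 * nK ^ 2) := by
  have hπ : 4 ≤ Real.pi ^ 2 := by nlinarith [Real.two_le_pi, Real.pi_pos]
  have hnK : 0 ≤ nK ^ 2 := sq_nonneg _
  have h1 : A * (s ^ 2 * nK ^ 2) ≤ nK ^ 2 := by
    rw [← mul_assoc]; exact mul_le_of_le_one_left hnK hAs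
  have h2 : 1 / 24 * (γ * nK) ^ 2 = Real.pi ^ 2 * nK ^ 2 / 2 := by rw [mul_pow, hγ]; ring
  have h3 : 2 * Real.pi ^ 2 * r ≤ 2 * Real.pi ^ 2 * nK ^ 2 := by gcongr
  have h4 := mul_nonneg hnK (sub_nonneg.2 hπ)
  have h5 : 0 ≤ A * (s ^ 2 * nK ^ 2) := mul_nonneg hA0 (by positivity)
  have h6 : 0 ≤ 1 / 24 * (γ * nK) ^ 2 := by positivity
  have h7 : 0 ≤ 2 * Real.pi ^ 2 * r := mul_nonneg (by positivity) hr0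
  refine (add_le_add (add_le_add hG le_rfl) le_rfl).trans (ofReal_add_three_le h5 h6 h7 ?_)
  nlinarith

/-- **Large `|K|`, conclusion** ((3.26)–(3.29) ⇒ (3.21)): if
`G₁ ≤ 4π²K² - ⅛s⁻² + 3D + 2C₀M` with `3D + 2C₀M + ⅙ + π²/2 ≤ ⅛s⁻² ≤ 2π²K²`, then
`G₁ + 4·(1/24) + 2π²(ℓ/L)² ≤ 4π²K²`. [cite: Fournais2020, (3.21), (3.29)] -/
theorem reduced_of_large {G : ℝ≥0∞} {s nK r D M C₀ : ℝ}
    (hG : G ≤ ENNReal.ofReal (4 * Real.pi ^ 2 * nK ^ 2 - s⁻¹ ^ 2 / 8 + 3 * D + 2 * C₀ * M))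
    (hE : 3 * D + 2 * C₀ * M + 1 / 6 + Real.pi ^ 2 / 2 ≤ s⁻¹ ^ 2 / 8)
    (hDM : 0 ≤ 3 * D + 2 * C₀ * M) (hK : s⁻¹ ^ 2 / 8 ≤ 2 * Real.pi ^ 2 * nK ^ 2) (hr0 : 0 ≤ r)
    (hr : 2 * Real.pi ^ 2 * r ≤ Real.pi ^ 2 / 2) :
    G + ENNReal.ofReal (1 / 24 * 4) + ENNReal.ofReal (2 * Real.pi ^ 2 * r) ≤
      ENNReal.ofReal (4 * Real.pi ^ 2 * nK ^ 2) := by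
  have hXY : 4 * Real.pi ^ 2 * nK ^ 2 - s⁻¹ ^ 2 / 8 + 3 * D + 2 * C₀ * M ≤
      4 * Real.pi ^ 2 * nK ^ 2 - 1 / 6 - Real.pi ^ 2 / 2 := by linarith
  have hY : 0 ≤ 4 * Real.pi ^ 2 * nK ^ 2 - 1 / 6 - Real.pi ^ 2 / 2 := by
    nlinarith [sq_nonneg Real.pi]
  calc G + ENNReal.ofReal (1 / 24 * 4) + ENNReal.ofReal (2 * Real.pi ^ 2 * r)
      ≤ ENNReal.ofReal (4 * Real.pi ^ 2 * nK ^ 2 - 1 / 6 - Real.pi ^ 2 / 2) +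
          ENNReal.ofReal (1 / 24 * 4) + ENNReal.ofReal (2 * Real.pi ^ 2 * r) := by
        gcongr
        exact hG.trans (ENNReal.ofReal_le_ofReal hXY)
    _ ≤ _ := ofReal_add_three_le hY (by norm_num) (mul_nonneg (by positivity) hr0) (by linarith)

end Assembly

/-! ### The theorems -/

section Main

/-- **Fournais 2020, (3.21)** — discharge of the named fact `Fournais2020_eq321`: for a
localisation function `χ` there are `b > 0` (`b = 1/24`) and `s₀ > 0` (depending on `χ` through
moments and seminorms of the Schwartz function `𝓕χ`) such that for `0 < s ≤ s₀`, `0 < ℓ`,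
`2ℓ < L` and `n ∈ ℤ³ ∖ {0}`: `ℓ⁻³⟨e_n, T_0 e_n⟩ + 2π²/L² ≤ 4π²|n|²/L²`, i.e.
`F(k) ≤ k² - 2π²L⁻²` for `k = 2πn/L`. [cite: Fournais2020, (3.21)–(3.29)] -/
theorem Fournais2020_eq321_holds : Fournais2020_eq321 := by
  intro χ hχ
  obtain ⟨f, hf⟩ := exists_schwartzMap_fourier hχ
  obtain ⟨C₀, hC₀⟩ := exists_norm_le_of_schwartz f
  obtain ⟨C₁, hC₁0, hC₁⟩ := exists_norm_fderiv_le_of_schwartz f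
  have hφc : Continuous f := f.continuous
  have hφd : Differentiable ℝ f := f.differentiable
  have hφ2 := integrable_normSq_of_schwartz f
  have hφq2 := integrable_pow_mul_normSq_of_schwartz f 2
  have hφq4 := integrable_pow_mul_normSq_of_schwartz f 4
  have hφq1 : Integrable fun q : Space => ‖q‖ ^ 2 * ‖f q‖ := f.integrable_pow_mul volume 2
  have hJ := integrable_inv_one_add_norm_pow_four
  have hnorm : ∫ q, ‖f q‖ ^ 2 = 1 := by
    have h := integral_normSq_fourier_eq_one hχ
    rwa [← hf] at h
  have heven : ∀ q, ‖f (-q)‖ = ‖f q‖ := fun q => by rw [hf, fourier_neg_of_even hχ.even q]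
  have hC00 : 0 ≤ C₀ := (norm_nonneg _).trans (hC₀ 0)
  -- the constants of (3.24)–(3.29): moments and seminorms of `φ = 𝓕χ`
  set D : ℝ := ∫ q : Space, 4 * Real.pi ^ 2 * ‖q‖ ^ 2 * ‖f q‖ ^ 2 with hD
  set M : ℝ := ∫ q : Space, 4 * Real.pi ^ 2 * ‖q‖ ^ 2 * ‖f q‖ with hM
  set J : ℝ := ∫ q : Space, ((1 + ‖q‖) ^ 4)⁻¹ with hJdef
  set C₄ : ℝ := ∫ q : Space, ‖q‖ ^ 4 * ‖f q‖ ^ 2 with hC₄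
  set A : ℝ := 2 * (4096 * Real.pi ^ 4 * C₁ ^ 2 * J) +
    2 * (2 * Real.sqrt 3 * Real.pi) ^ 2 * (16 * Real.pi ^ 4) * C₄ with hA
  set E : ℝ := 3 * D + 2 * C₀ * M + 1 / 6 + Real.pi ^ 2 / 2 with hE
  have hD0 : 0 ≤ D := integral_nonneg fun q => by positivity
  have hM0 : 0 ≤ M := integral_nonneg fun q => by positivity
  have hJ0 : 0 ≤ J := integral_nonneg fun q => by positivity
  have hC₄0 : 0 ≤ C₄ := integral_nonneg fun q => by positivity
  have hA0 : 0 ≤ A :=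
    add_nonneg (mul_nonneg zero_le_two (mul_nonneg (by positivity) hJ0))
      (mul_nonneg (by positivity) hC₄0)
  have hDM : 0 ≤ 3 * D + 2 * C₀ * M := by
    have := mul_nonneg (mul_nonneg zero_le_two hC00) hM0
    linarith
  have hE0 : 0 < E := by
    have := sq_nonneg Real.pi
    linarith
  set S : ℝ := 1 + A + 8 * E with hS
  have hS0 : 0 < S := by linarith
  -- `b = 1/24`, `s₀ = (1 + A + 8E)^{-1/2}`
  refine ⟨1 / 24, (Real.sqrt S)⁻¹, by norm_num, inv_pos.2 (Real.sqrt_pos.2 hS0), ?_⟩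
  intro s hs hss₀ ℓ L hℓ hL n hn
  have hL0 : 0 < L := by linarith
  have hs2 : s ^ 2 ≤ S⁻¹ := by
    have h := pow_le_pow_left₀ hs.le hss₀ 2
    rwa [inv_pow, Real.sq_sqrt hS0.le] at h
  have hsinv : S ≤ s⁻¹ ^ 2 := by
    have h := inv_anti₀ (pow_pos hs 2) hs2
    rwa [inv_inv, ← inv_pow] at h
  have hAs : A * s ^ 2 ≤ 1 := by
    calc A * s ^ 2 ≤ A * S⁻¹ := mul_le_mul_of_nonneg_left hs2 hA0
      _ ≤ 1 := by
          rw [← div_eq_mul_inv, div_le_one hS0]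
          linarith
  have hEs : 3 * D + 2 * C₀ * M + 1 / 6 + Real.pi ^ 2 / 2 ≤ s⁻¹ ^ 2 / 8 := by linarith
  have hγ2 : (2 * Real.sqrt 3 * Real.pi) ^ 2 = 12 * Real.pi ^ 2 := by
    rw [mul_pow, mul_pow, Real.sq_sqrt (by norm_num : (0 : ℝ) ≤ 3)]; ring
  have hr : ℓ ^ 2 / L ^ 2 ≤ ‖ℓ • (toLp 2 fun j => (n j : ℝ) / L : Space)‖ ^ 2 :=
    sq_div_sq_le_norm_sq ℓ hL0 hn
  have hr2 := two_pi_sq_mul_le hℓ hL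
  have hr0 : 0 ≤ ℓ ^ 2 / L ^ 2 := by positivity
  rcases le_or_gt ‖ℓ • (toLp 2 fun j => (n j : ℝ) / L : Space)‖ (4 * Real.pi * s)⁻¹ with hKs | hKs
  · -- small `|K|`: (3.24)–(3.25)
    have hc1 := norm_cellWave_sub_boxAverage_le hℓ L n (zero_mem_slidingBox hℓ.le)
    rw [cellWave_apply_zero] at hc1
    have hβpt : ∀ x ∈ slidingBox ℓ 0,
        ‖cellWave L n x - ((ℓ ^ 3)⁻¹ : ℝ) • ∫ y in slidingBox ℓ 0, cellWave L n y‖ ^ 2 ≤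
          (2 * Real.sqrt 3 * Real.pi * ‖ℓ • (toLp 2 fun j => (n j : ℝ) / L : Space)‖) ^ 2 :=
      fun x hx => pow_le_pow_left₀ (norm_nonneg _) (norm_cellWave_sub_boxAverage_le hℓ L n hx) 2
    have hkin := kinLoc_cellWave_le hχ hℓ L n s (b := 1 / 24) (by norm_num) (sq_nonneg _) hβpt
    rw [← hf] at hkin
    refine eq321_of_reduced hℓ L n hkin ?_
    exact reduced_of_small (lintegral_G1_le_small hφc hφd hC₁0 hC₁ hφq4 hJ hs hKs hc1)
      hA0 hAs hr0 hr hγ2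
  · -- large `|K|`: (3.26)–(3.29)
    have hc1 := norm_boxAverage_le_one hℓ L n
    have hβpt : ∀ x ∈ slidingBox ℓ 0,
        ‖cellWave L n x - ((ℓ ^ 3)⁻¹ : ℝ) • ∫ y in slidingBox ℓ 0, cellWave L n y‖ ^ 2 ≤ 4 :=
      fun x _ => (pow_le_pow_left₀ (norm_nonneg _)
        (norm_cellWave_sub_boxAverage_le_two hℓ L n x) 2).trans_eq (by norm_num)
    have hkin := kinLoc_cellWave_le hχ hℓ L n s (b := 1 / 24) (by norm_num) (by norm_num) hβpt
    rw [← hf] at hkin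
    refine eq321_of_reduced hℓ L n hkin ?_
    exact reduced_of_large
      (lintegral_G1_le_large hφc hC₀ hφ2 hφq2 hφq1 hnorm heven hs hKs.le hc1)
      hEs hDM (inv_sq_div_eight_le hs hKs.le) hr0 hr2

/-- **Fournais 2020, Lemma 3.3** (kinetic-energy localisation) — discharge of the named fact
`Fournais2020_lemma33` (`PeriodicBoseGasLocalization.lean`): from (3.21)
(`Fournais2020_eq321_holds`) by the diagonalisation (3.19)–(3.20) and Fatou
(`Fournais2020_lemma33_of_eq321`, `PeriodicBoseGasLemma33.lean`).
[cite: Fournais2020, Lemma 3.3 (3.12)–(3.13)] -/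
theorem Fournais2020_lemma33_holds : Fournais2020_lemma33 :=
  Fournais2020_lemma33_of_eq321 Fournais2020_eq321_holds

/-- **Theorem 3.1 from the two remaining named facts**: with Lemma 3.2
(`Fournais2020_lemma32_holds`) and Lemma 3.3 (`Fournais2020_lemma33_holds`) discharged, the
sliding-localisation assembly `Fournais2020_thm31_of_localization` (`PeriodicBoseGasThm31.lean`)
reduces Theorem 3.1 to the existence of the scattering solution (`LSSY2005_scatteringSolution`,
[LSSY2005, Thm. C.1]) and the small-box bound (3.17) (`Fournais2020_eq317`, i.e. Thm. 2.1 =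
[BrietzkeFournaisSolovej2020, Thm. 6.1]). [cite: Fournais2020, Thm. 3.1, (3.14)–(3.17)] -/
theorem Fournais2020_thm31_of_scattering_eq317 (hSS : LSSY2005_scatteringSolution)
    (h317 : Fournais2020_eq317) : Fournais2020_thm31 :=
  Fournais2020_thm31_of_localization hSS Fournais2020_lemma33_holds h317

/-- **Theorem 1.2 from the two remaining named facts** (`LSSY2005_scatteringSolution`,
`Fournais2020_eq317`), via Theorem 3.1 and Remark (1.10)–(1.12)
(`Fournais2020_condensation_of_thm31`, `PeriodicBoseGasProofs.lean`).
[cite: Fournais2020, Thm. 1.2, Thm. 3.1] -/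
theorem Fournais2020_condensation_of_scattering_eq317 (hSS : LSSY2005_scatteringSolution)
    (h317 : Fournais2020_eq317) : Fournais2020_condensation :=
  Fournais2020_condensation_of_localization hSS Fournais2020_lemma33_holds h317

end Main

end Literature.MathematicalPhysics.QuantumManyBody.BoseGas
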